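import Summits.AtomisticToContinuum.Crystallization.Theses.ReggeStarCoercivity
import Literature.MathematicalPhysics.StatisticalMechanics.PeriodicConfigurationSums
import Literature.MathematicalPhysics.StatisticalMechanics.LennardJonesClusters
import Literature.Barriers.AtomisticToContinuum.SutoDegenerateGroundStates
import Literature.MathematicalPhysics.StatisticalMechanics.StablePotentialsProofs

/-!
# Disproof of `StarCoercivity` (stmt-AtomisticToContinuum-13600) — standing adversary, generation 3

Crux (route `ReggeStarCoercivity`, rank-2, thesis X):
`∃ g > 0, ∃ C, ∀ N, ∀ x : Fin N → ℝ³ injective,  N·e_per + g·#Def(x) − C·N^(2/3) ≤ E_LJ(x)`,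
`e_per = ⨅_Q e(Q)` over `PeriodicConfiguration 3`, `#Def(x)` = number of sites whose recentred
`6/5`-shell, rescaled by some `a ∈ [9/10, 11/10]`, is NOT `1/20`-matched (bijection after a
linear isometry) to `fccKissingPattern`/`hcpKissingPattern` (twelve unit vectors).

**Verdict after three generations: RESISTS — and is, in a precise sense, not cheaply refutable;**
**structural theorems closed: the `C·N^(2/3)` allowance is redundant (§8); (g3) the crux is the**
**SIGN OF ONE REAL NUMBER, `StarCoercivity ↔ BddBelow ∧ 0 < g⋆` with `g⋆ = inf` of the defect**
**quotients, the supremum of admissible `g` being attained (§10); and (g3, §9 + §12)**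
**`StarCoercivity ↔ PeriodicStarCoercivity` with the SAME constant — items 13600 and 13602 are**
**one statement, `g⋆ = g⋆_per`, so every periodic competitor with a defective motif point is a**
**certified cap on `g` (`g_le_periodicQuotient`).**
Everything below is `lean check`ed (rc 0, no `sorry`, axioms ⊆ {propext, choice, Quot.sound}).

## Findings (index)

* §0 `ePer`, `IsDefective`, `defects`, `StarCoercivityWith g C`; `starCoercivity_iff` (`Iff.rfl`:
  the crux is literally `∃ g > 0, ∃ C, StarCoercivityWith g C`).
* §1 bookkeeping: `defects_le` (`#Def ≤ N`), `StarCoercivityWith.mono` (down-set in `g`, up-set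
  in `C`), `starCoercivity_iff_nat` (countable normal form `(g, C) = (1/(n+1), n+1)`).
* §2–3 VACUUM TIGHTNESS `g_le_neg_ePer : StarCoercivityWith g C → g ≤ −e_per` (collinear points
  at spacing 2: all shells empty, energy ≤ 0); hence `ePer_neg_of_starCoercivity` and — new in
  g2 — `bddBelow_of_starCoercivity : StarCoercivity → BddBelow (range e)`: the side condition
  every `ciInf` step needs (periodic LJ energies bounded below, NOT yet in the tree) is OUTPUT of
  the crux, so the glue items 13605/13606 may derive it from their hypothesis `StarCoercivity`.
* §4 LOAD-BEARING HYPOTHESIS `not_starCoercivityNonInj`: drop `Function.Injective x` and the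
  statement is false for every `g > 0`, `C` (`V_LJ(0) = 0` pile-up `pile k`: `k` particles on
  each of two points at distance 1, energy `−k²/12`; needs no stability input thanks to
  `exists_neg_le_ePer`).  Injectivity is the only hypothesis on `x`; any proof must use it.
* §5 POSITIVE REDUCTION `card_mul_ePer_le_interactionEnergy : BddBelow → N·e_per ≤ E_LJ(x)` for
  every injective `x` (periodisation `periodise` with the tree's `cubicLattice`, period
  `2Σ‖xᵢ‖ + 2`; `le_norm_of_mem_cubicLattice`; `sum_le_hasSum` on the negated summable lattice
  sum), i.e. `starCoercivityWith_zero_zero`; and `starCoercivityWith_zero_zero_iff` (`↔ BddBelow`: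
  in the junk world the dimer has energy `−1/12 < 0 = N·⨅`).  `nearMinimiser_of_violation`
  states the obstruction formally (see "Why it resists").  `not_starCoercivity_iff` unfolds `¬`.
* §6 NON-VACUITY of the defect predicate as typed, one witness per disjunct:
  `not_isDefective_fccCluster_zero`, `not_isDefective_hcpCluster_zero` (centres of
  `{0} ∪ fcc/hcpKissingPattern`, `a = 1`, `A = id`; generic `patternCluster`), `exists_free_site`,
  `defects_fcc/hcpCluster_lt`; defective sites exist too (`defects_lineConfig`, `defects_pile`).
* §7 `starCoercivityLinearSlack` (unconditional theorem): with slack `C·N` in place of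
  `C·N^(2/3)` the statement is trivially true (finite stability `lennardJones_stable_holds` /
  periodisation, `#Def ≤ N`).  The content of the crux is exactly the SUBLINEAR slack.
* §8 **THE BOUNDARY ALLOWANCE IS REDUNDANT** `StarCoercivityWith.zero_slack :
  StarCoercivityWith g C → StarCoercivityWith g 0` (translated copies `copies x K`: exactly
  `K·#Def(x)` defective sites, energy `≤ K·E_LJ(x)`; a `C = 0` violation by `Δ` becomes a
  `(g, C)` violation `KΔ − C(KN)^(2/3) → ∞`; needs neither periodic configurations nor `e_per` nor
  stability).  Hence `starCoercivity_iff_zero_slack : StarCoercivity ↔ ∃ g > 0,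
  StarCoercivityWith g 0`, and §3 is its `N = 1` case (`g_le_neg_ePer'`); the unit dimer gives
  `g_le_of_dimer : g ≤ −e_per − 1/24` (how explicit all-defective clusters cap `g` RELATIVE to
  `e_per` — never absolutely).
* §9 **13602 ⇒ 13600** `starCoercivity_of_periodicStarCoercivity : PeriodicStarCoercivity →
  StarCoercivity` (sorry-free; the planners' crux note had it as a `sorry`): the periodisation
  of §5 has its shells-read-in-`P.points` equal to the shells of `x`
  (`toFinset_inter_points_image`, `card_filter_motif_periodise`).  The route files 13602 with
  `deps: StarCoercivity`; the converse dependency is now a theorem, so a refutation of 13600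
  sinks 13602 too, and periodic competitors test 13600 directly.
* §10 (g3) **ONE REAL NUMBER** `gStar = sInf quotientSet`, the infimum of the DEFECT QUOTIENTS
  `(E_LJ(x) − N·e_per)/#Def(x)` over injective `x` with `#Def(x) > 0`:
  `le_gStar_of_starCoercivityWith : StarCoercivityWith g C → g ≤ g⋆` (no hypothesis),
  `starCoercivityWith_gStar : BddBelow → StarCoercivityWith g⋆ 0` (the supremum of admissible
  `g` IS ATTAINED), `starCoercivityWith_iff_le_gStar : StarCoercivityWith g C ↔ g ≤ g⋆`
  (`C ≥ 0`), `starCoercivity_iff_gStar_pos : StarCoercivity ↔ BddBelow ∧ 0 < g⋆`,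
  `not_starCoercivity_iff_gStar`, `gStar_nonpos_iff` (kill criterion: for every `ε > 0` an
  injective `x` with `0 < #Def` and excess `< ε·#Def`), ceilings `gStar_le_neg_ePer`,
  `gStar_le_of_dimer` (relative to `e_per`).
* §11 (g3) the torus twin: `motifDefects`, `PeriodicStarCoercivityWith g`
  (`periodicStarCoercivity_iff`, `Iff.rfl`), `gPer = sInf periodicQuotientSet`;
  `periodicStarCoercivity_iff_gPer_pos : PeriodicStarCoercivity ↔ BddBelow ∧ 0 < g⋆_per`,
  `periodicStarCoercivityWith_iff_le_gPer`, and **`gPer_le_gStar : g⋆_per ≤ g⋆`** (every finite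
  defect quotient dominates the quotient of its periodisation).
* §12 (g3) **BLOCKS OF A PERIODIC CONFIGURATION** (≈ 700 lines, the converse of §9/§11): a
  `ℤ`-basis of the period lattice (`latticeBasis`, `realBasis = ofZLatticeBasis`, `latVec`,
  `exists_latVec_of_mem`), the block `blockPt P n : (Fin 3 → Fin n) × motif → ℝ³` (injective,
  in `P.points`), lattice sums `siteSum` with `siteSum_add_of_mem` (translation invariance via
  `shiftEquiv`), tails `tailSum`/`invSixSum` with `exists_tailSum_lt`
  (`tendsto_tsum_compl_atTop_zero`), a uniform coordinate bound `abs_repr_le` (operator norm of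
  the coordinate functionals) giving the interior margin `margin R` and the key geometric lemma
  `exists_blockIdx_of_dist_le` (an interior block point sees only block points within `R`);
  whence the ENERGY BOUND `sum_sum_blockPt_le'`
  (`2E(block) ≤ n³·2m·e(P) + (1/6)(N·tailB(R) + #non-interior·fullB)`, using
  `V_LJ ≥ −r⁻⁶/6` and `Summable.sum_add_tsum_compl`), the SHELL IDENTITY `shellOn_blockPt`
  (interior shells of the block = shells read in `P.points`) and the DEFECT UNDERCOUNT
  `le_defectsOn_blockPt` (`#Def(block of side n'+2r) ≥ n'³·motifDefects P`); assembled in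
  `periodicStarCoercivityWith_of_starCoercivityWith : BddBelow → StarCoercivityWith g 0 →
  PeriodicStarCoercivityWith g`.  Consequences: `gStar_eq_gPer`,
  `starCoercivityWith_iff_periodicStarCoercivityWith`,
  **`starCoercivity_iff_periodicStarCoercivity : StarCoercivity ↔ PeriodicStarCoercivity`**
  (no hypothesis), and the adversary's tool `g_le_periodicQuotient : 0 < g →
  StarCoercivityWith g C → 0 < motifDefects P → g ≤ periodicQuotient P`.  Trial blocks
  `exists_block_energy_le` (`∀ P ε n₀, ∃ N ≥ n₀, ∃ x injective, E_LJ(x) ≤ N·(e(P) + ε)` — the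
  finite-volume half of item 11865/0629 `CrysEnergyUpper` along `N = n³·#motif`; general `N`
  by padding with far particles is left to its prover) and, with the tree's finite stability
  `lennardJones_stable_holds`, **`bddBelow_range_energyPerParticle` = item 0714 PROVED here**
  (10 lines on top of the blocks; a sibling seat attached independent candidates to 0714), so
  every `BddBelow` hypothesis in this file is discharged: primed unconditional versions
  `starCoercivity_iff_gStar_pos' : StarCoercivity ↔ 0 < g⋆`, `periodicStarCoercivity_iff_gPer_pos'`,
  `gStar_eq_gPer'`, `starCoercivityWith_gStar'`, `starCoercivityWith_iff_le_gStar'`,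
  `card_mul_ePer_le_interactionEnergy'` (`N·e_per ≤ E_LJ(x)` for every injective `x`),
  `gStar_nonneg'`, and the kill criterion `not_starCoercivity_iff'`.

## Why it resists (read this before trying to kill it)

By §5 (unconditional since g3: `card_mul_ePer_le_interactionEnergy'`),
`excess(x) := E_LJ(x) − N·e_per ≥ 0` for every finite injective `x`.
A witness against `(g, C)` therefore satisfies `0 ≤ excess(x) < g·#Def(x) − C N^(2/3) ≤ g·N`
(`nearMinimiser_of_violation`): it is a NEAR-MINIMISER with macroscopic defect density, and a
refutation needs such witnesses for EVERY `g > 0`.  Certifying `excess(x) < gN` in Lean requires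
`e_per ≥ E_LJ(x)/N − g`, a LOWER bound on the periodic minimum sharp to precision `g` along an
explicit family — i.e. the energetic crystallization lower bound (Blanc–Lewin 2015 §2.3, open in
`d = 3`).  Consequently NO quantitative variant (a specific `g`, a narrowed `a`-window such as
`[1, 11/10]`, a larger shell radius `7/5`, `C = 0`, a smaller exponent) is Lean-refutable either:
each needs the same lower bound.  Only junk-driven variants (§4) and sign/tightness facts
(§3, §7) are certifiable.  The tree's unconditional floor is `E ≥ −(2³²/12)N`
(`le_interactionEnergy_lennardJones`) and Yuhjtman's `−1.193N`; the gap to `e_per ≈ −0.7177` is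
where every refutation attempt dies.

## Physics ledger: forced upper bounds on `g` (numerics; granted `e_per = e(hcp) ≈ −0.71772`)

(Blanc–Lewin units `V = r⁻¹²/12 − r⁻⁶/6`, `a* = 0.9712`; sources: refuter-rattack job j004057,
gen-1 folder numerics quoted from its evidence notes v2/v2.1, and the elementary estimates below.)
`δ/f` = excess per particle over defect fraction of a periodic/bulk competitor; `StarCoercivity`
forces `g ≤ inf δ/f`.
* vacuum (isolated atoms) 0.718 (= −e_per; §3 is its Lean form) · dimers 0.68 · sc 0.243 ·
  sh 0.153 · bcc 0.031 (14 points in the 6/5-ball) · A15 rigid 0.086 · FK phases ~1e-2 ·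
  vacancy 0.060 (excess ≈ −e_per − relaxation over 12 defective neighbours) · dilated fcc
  `d = 1.155⁺` 0.30, compressed `d = 0.855⁻` 0.95 (window edges are far from `a*`).
* homogeneous strains at the exact predicate threshold (j004057): Bain+ 0.0084, ortho 0.0087,
  Bain− 0.0145, shears 0.023–0.027, trigonal 0.027–0.031.
* BINDING so far (gen 1): rigid basal/{111} slip at the matching threshold `u* ≈ 0.087 d`
  (bottleneck ≈ 0.577 u/d), `γ(u*) ≈ 0.0115–0.0117` per plane site, two defective layers
  ⇒ `g ≤ 5.7e-3`.
* NOT binding (corrections recorded in g2): a single displaced atom makes ITSELF defective at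
  `|u| = a/20` (a uniform shift of a centrosymmetric 12-shell cannot be absorbed by a LINEAR map:
  for antipodal `p, −p` the two residuals sum to `2u`), but each NEIGHBOUR sees one displaced
  point out of twelve and the minimax fit over dilation/rotation halves the residual, so the
  neighbours turn defective only at `|u| ≈ a/10`; ratio ≈ ½·k_site·(a/10)²/13 ≈ 1.5e-2
  (k_site ≈ 41, NN harmonic), not 4e-3.  The densest arrangement of such centres is a perfect
  1-code of the fcc contact graph, which EXISTS: the index-13 sublattice
  `ker(x + 3y + 9z mod 13) ∩ D₃` (the twelve minimal vectors hit the twelve non-zero residues),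
  every other site adjacent to exactly one centre — same ratio ≈ 1.5e-2.  Zone-boundary phonons
  at threshold ≈ 0.2; long-wave shear at threshold ≈ 2.5e-2 (≈ 2.7γ_c², γ_c ≈ 0.1; j004057:
  0.023–0.027).
* Free (uncharged) by construction: every Barlow stacking (fcc/hcp/dhcp/9R…), stacking faults
  and coherent twins (hcp-type shells), uniform dilations `d ∈ [0.855, 1.155]`, decahedral
  wedges (0.67–2 % strain < 1/20; only the five-fold axis column ~N^(1/3) is charged), Mackay
  icosahedra (finite-N winners) are absorbed by `∃ C`.
* Harmonic floor (heuristic): fcc/hcp are Born-stable, so any displacement pattern making a set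
  D of sites defective costs ≳ C_min·(1/20)²·|D|; no soft route to `δ/f → 0` at small strain.
  A genuine counterexample would have to be a NON-Barlow periodic structure with `e = e_per`
  exactly (degenerate ground state with defective sites), or a sequence of structures with
  `δ/f → 0`; none is known or suspected for LJ 12-6 (route sources Stillinger2001,
  PartayOrtnerCsanyi2017 — nested sampling finds only close-packed polytypes at low pressure —,
  BlancLewin2015 §2.5; sparse dislocations/low-angle boundaries have `δ/f → ∞` (log), so
  `inf δ/f` is attained among dense defect structures).  lit/galaxy search-degraded (rc 75) at
  2026-08-15T23:1xZ, so this paragraph rests on the route's own sources, not a fresh search.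
So the admissible `g` is ≲ 6e-3 but every bound is POSITIVE: consistent with `∃ g > 0`.

## What g2 could not reuse
The generation-1 file (v2.1, 31 KB, evidence 2026-08-15T22:36:07Z) is not readable on this
hub (the path printed by `ledger workitem evidence latest` does not exist on the compute-free
box); this file is a from-scratch rebuild of its announced content (`StarCoercivityWith`,
`starCoercivity_iff`, `starCoercivity_false_without_injective` ↦ `not_starCoercivityNonInj`,
`g_le_neg_ePer`, `card_mul_ePer_le_interactionEnergy`, `starCoercivityWith_zero_zero`) plus the
new §3 `bddBelow_of_starCoercivity`, §5 `…_iff`/`nearMinimiser_of_violation`, §6, §7.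

## Prover notes made visible here
(i) `BddBelow (range e)` (periodic LJ stability) is NOT on this route's critical path: the crux
implies it (§3), 13606 gets it from 0627's `IsLeast`, and 11865 holds in the junk case too
(`⨅ = 0 ≥ limsup E(N)/N` since `E(N) ≤ 0`); the unconditional form of §5 wants it, and §12's
block energy bound + the tree's finite stability `lennardJones_stable_holds` now give it a
short proof (`e(P) ≥ E(block)/N − o(1) ≥ −B − o(1)`; left to a prover).  (ii) By §8 provers may
aim at the `C = 0` form or at any convenient `C`; by §9 + §12 they may prove 13602 INSTEAD OF
13600 — the two items are equivalent with the same `g` (`starCoercivity_iff_periodicStarCoercivity`),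
so the torus form (finite Delaunay triangulation, exact flatness, no boundary) is a legitimate
home for the whole crux.  (iii) Nothing in this file lower-bounds `e_per`; that is the crux.
(iv) §8–§12 are positive theorems a prover can land verbatim under `Theorems/` with
`--supports stmt-AtomisticToContinuum-13600` (or `--workitem` 13602 ⇒ 13600 glue).

## Targets
payload.stuck_stubs = [] and targets = [] at this generation: no lead stubs to attack yet.
-/

noncomputable section

namespace Summit.AtomisticToContinuum.Crystallization.Cruxes.StarCoercivity.Disproof

open scoped BigOperators Classical
open Literature.MathematicalPhysics.StatisticalMechanics Literature.Geometry.DiscreteGeometry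
open Summit.AtomisticToContinuum.Crystallization.Theses.ReggeStarCoercivity (StarCoercivity)

/-- Euclidean `3`-space. -/
local notation "E3" => EuclideanSpace ℝ (Fin 3)

/-! ## §0 The crux unfolded: `e_per`, the defect count, `StarCoercivityWith g C` -/

/-- `e_per = ⨅_Q e(Q)`, the infimum over periodic configurations of `ℝ³` of the Lennard-Jones
energy per particle (a conditionally complete infimum: junk value `0` if the range were not
bounded below). [folklore] -/
def ePer : ℝ := ⨅ Q : PeriodicConfiguration 3, Q.energyPerParticle lennardJones

/-- The recentred, `a⁻¹`-rescaled first shell (absolute radius `6/5`) of site `i`, verbatim from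
the crux. [folklore] -/
def shell {N : ℕ} (x : Fin N → E3) (i : Fin N) (a : ℝ) : Finset E3 :=
  (Finset.univ.filter fun j : Fin N => j ≠ i ∧ dist (x i) (x j) ≤ 6 / 5).image
    fun j => a⁻¹ • (x j - x i)

/-- Site `i` is DEFECTIVE (verbatim from the crux, through `shell`): no dilation
`a ∈ [9/10, 11/10]` makes its shell `1/20`-close (bijectively, after a linear isometry) to the
fcc or the hcp kissing pattern. [folklore] -/
def IsDefective {N : ℕ} (x : Fin N → E3) (i : Fin N) : Prop :=
  ¬ ∃ a : ℝ, 9 / 10 ≤ a ∧ a ≤ 11 / 10 ∧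
    (ShellCloseTo (1 / 20) (shell x i a) fccKissingPattern ∨
     ShellCloseTo (1 / 20) (shell x i a) hcpKissingPattern)

/-- The number of defective sites `#Def(x)`. [folklore] -/
def defects {N : ℕ} (x : Fin N → E3) : ℕ := Nat.card {i : Fin N // IsDefective x i}

/-- The crux inequality with the two constants exposed:
`N·e_per + g·#Def(x) − C·N^(2/3) ≤ E_LJ(x)` for every injective `x`. [folklore] -/
def StarCoercivityWith (g C : ℝ) : Prop :=
  ∀ (N : ℕ) (x : Fin N → E3), Function.Injective x →
    (N : ℝ) * ePer + g * (defects x : ℝ) - C * (N : ℝ) ^ (2 / 3 : ℝ) ≤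
      interactionEnergy lennardJones x

/-- The crux is literally `∃ g > 0, ∃ C, StarCoercivityWith g C`. [folklore] -/
theorem starCoercivity_iff : StarCoercivity ↔ ∃ g : ℝ, 0 < g ∧ ∃ C : ℝ, StarCoercivityWith g C :=
  Iff.rfl

/-! ## §1 Bookkeeping lemmas -/

/-- `#Def(x) ≤ N`. [folklore] -/
theorem defects_le {N : ℕ} (x : Fin N → E3) : defects x ≤ N := by
  unfold defects
  calc Nat.card {i : Fin N // IsDefective x i} ≤ Nat.card (Fin N) := Finite.card_subtype_le _
    _ = N := by simp

/-- If every site is defective then `#Def(x) = N`. [folklore] -/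
theorem defects_eq_of_forall {N : ℕ} {x : Fin N → E3} (h : ∀ i, IsDefective x i) :
    defects x = N := by
  unfold defects
  rw [Nat.card_congr (Equiv.subtypeUnivEquiv h)]
  simp

/-- A site whose rescaled shell never has exactly twelve points is defective (a `1/20`-matched
shell is in bijection with a twelve-point pattern). [folklore] -/
theorem isDefective_of_card_ne {N : ℕ} {x : Fin N → E3} {i : Fin N}
    (h : ∀ a : ℝ, 9 / 10 ≤ a → a ≤ 11 / 10 → (shell x i a).card ≠ 12) : IsDefective x i := by
  rintro ⟨a, ha₁, ha₂, hclose⟩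
  exact h a ha₁ ha₂ (card_eq_twelve_of_shellCloseTo hclose)

/-- Monotonicity: the admissible constants form a down-set in `g` and an up-set in `C`.
[folklore] -/
theorem StarCoercivityWith.mono {g g' C C' : ℝ} (h : StarCoercivityWith g C) (hg : g' ≤ g)
    (hC : C ≤ C') : StarCoercivityWith g' C' := by
  intro N x hx
  have h1 := h N x hx
  have hd : (0 : ℝ) ≤ (defects x : ℝ) := Nat.cast_nonneg _
  have hN : (0 : ℝ) ≤ (N : ℝ) ^ (2 / 3 : ℝ) := Real.rpow_nonneg (Nat.cast_nonneg N) _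
  nlinarith [mul_le_mul_of_nonneg_right hg hd, mul_le_mul_of_nonneg_right hC hN]

/-- `(M³)^(2/3) = M²`: the particle numbers used below are perfect cubes, which keeps the
`N^(2/3)` bookkeeping inside `ring`. [folklore] -/
theorem cube_rpow_two_thirds (M : ℕ) : (((M : ℝ) ^ 3) ^ (2 / 3 : ℝ)) = (M : ℝ) ^ 2 := by
  have hM : (0 : ℝ) ≤ (M : ℝ) := Nat.cast_nonneg M
  rw [show ((M : ℝ) ^ 3) = (M : ℝ) ^ (3 : ℝ) by norm_cast, ← Real.rpow_mul hM]
  norm_num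

/-! ## §2 The vacuum competitor: `N` collinear points at mutual distances `≥ 2` -/

/-- The unit vector `e₀`. -/
def e0 : E3 := EuclideanSpace.single 0 1

theorem norm_e0 : ‖e0‖ = 1 := by simp [e0]

/-- `N` points on a line, spacing `2`: every `6/5`-shell is empty, every pair term is `≤ 0`.
[folklore] -/
def lineConfig (N : ℕ) : Fin N → E3 := fun i => ((2 : ℝ) * (i : ℕ)) • e0

theorem dist_lineConfig {N : ℕ} (i j : Fin N) :
    dist (lineConfig N i) (lineConfig N j) = 2 * |((i : ℕ) : ℝ) - ((j : ℕ) : ℝ)| := by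
  simp only [lineConfig, dist_eq_norm, ← sub_smul, norm_smul, norm_e0, mul_one, ← mul_sub,
    Real.norm_eq_abs, abs_mul, abs_two]

theorem two_le_dist_lineConfig {N : ℕ} {i j : Fin N} (hij : i ≠ j) :
    2 ≤ dist (lineConfig N i) (lineConfig N j) := by
  rw [dist_lineConfig]
  have hne : (i : ℕ) ≠ (j : ℕ) := fun h => hij (Fin.ext h)
  have h1 : (1 : ℝ) ≤ |((i : ℕ) : ℝ) - ((j : ℕ) : ℝ)| := by
    rcases Nat.lt_or_gt_of_ne hne with h | h
    · have : ((i : ℕ) : ℝ) + 1 ≤ ((j : ℕ) : ℝ) := by exact_mod_cast h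
      rw [abs_of_neg (by linarith)]
      linarith
    · have : ((j : ℕ) : ℝ) + 1 ≤ ((i : ℕ) : ℝ) := by exact_mod_cast h
      rw [abs_of_pos (by linarith)]
      linarith
  linarith

theorem lineConfig_injective (N : ℕ) : Function.Injective (lineConfig N) := by
  intro i j hij
  by_contra hne
  have h := two_le_dist_lineConfig (N := N) hne
  rw [hij, dist_self] at h
  linarith

/-- Every shell of the collinear configuration is empty, so every site is defective. [folklore] -/
theorem shell_lineConfig {N : ℕ} (i : Fin N) (a : ℝ) : shell (lineConfig N) i a = ∅ := by
  unfold shell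
  rw [Finset.image_eq_empty, Finset.filter_eq_empty_iff]
  rintro j - ⟨hji, hdist⟩
  have := two_le_dist_lineConfig (N := N) (Ne.symm hji)
  linarith

theorem defects_lineConfig (N : ℕ) : defects (lineConfig N) = N :=
  defects_eq_of_forall fun i => isDefective_of_card_ne fun a _ _ => by
    rw [shell_lineConfig i a]; simp

theorem interactionEnergy_lineConfig_nonpos (N : ℕ) :
    interactionEnergy lennardJones (lineConfig N) ≤ 0 := by
  unfold interactionEnergy
  refine Finset.sum_nonpos fun i _ => Finset.sum_nonpos fun j hj => ?_
  have hij : i ≠ j := (Finset.mem_Ioi.1 hj).ne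
  exact lennardJones_nonpos (by linarith [two_le_dist_lineConfig (N := N) hij])

/-! ## §3 Tightness at the vacuum and the first structural consequence

`StarCoercivityWith g C` forces `g ≤ −e_per`: the collinear vacuum competitor has `#Def = N`
and energy `≤ 0`.  Two corollaries: the crux implies `e_per < 0`, and the crux implies that
the periodic energies per particle ARE bounded below (otherwise `e_per` is Lean's junk `0`):
the `BddBelow` side condition every `ciInf` manipulation needs is OUTPUT of the crux, so glue
items consuming `StarCoercivity` (13605, 13606) may derive it instead of proving periodic
stability. -/

/-- **Tightness at the vacuum**: `StarCoercivityWith g C → g ≤ −e_per`. [folklore] -/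
theorem g_le_neg_ePer {g C : ℝ} (h : StarCoercivityWith g C) : g ≤ -ePer := by
  by_contra hlt
  push Not at hlt
  set c : ℝ := ePer + g with hc_def
  have hc : 0 < c := by rw [hc_def]; linarith
  -- `N = M³` particles with `c·M > |C|`
  obtain ⟨M, hM⟩ := exists_nat_gt (|C| / c)
  have hMpos : (0 : ℝ) < M := lt_of_le_of_lt (by positivity) hM
  have key := h (M ^ 3) (lineConfig (M ^ 3)) (lineConfig_injective _)
  rw [defects_lineConfig] at key
  have hE := interactionEnergy_lineConfig_nonpos (M ^ 3)
  push_cast at key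
  rw [cube_rpow_two_thirds] at key
  -- `c·M³ ≤ C·M²`
  have h1 : c * (M : ℝ) ^ 3 ≤ C * (M : ℝ) ^ 2 := by rw [hc_def]; nlinarith
  have h2 : c * (M : ℝ) ≤ C := by
    have hM2 : (0 : ℝ) < (M : ℝ) ^ 2 := by positivity
    have : c * (M : ℝ) * (M : ℝ) ^ 2 ≤ C * (M : ℝ) ^ 2 := by nlinarith
    exact le_of_mul_le_mul_right this hM2
  have h3 : |C| < c * (M : ℝ) := by rwa [div_lt_iff₀ hc, mul_comm] at hM
  linarith [le_abs_self C]

/-- Hence the crux forces `e_per < 0`. [folklore] -/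
theorem ePer_neg_of_starCoercivity (h : StarCoercivity) : ePer < 0 := by
  obtain ⟨g, hg, C, hgC⟩ := starCoercivity_iff.1 h
  linarith [g_le_neg_ePer hgC]

/-- **The crux implies that periodic Lennard-Jones energies are bounded below** (else `⨅ = 0`
by `Real.iInf_of_not_bddBelow`, contradicting `g ≤ −e_per`, `g > 0`). [folklore] -/
theorem bddBelow_of_starCoercivity (h : StarCoercivity) :
    BddBelow (Set.range fun Q : PeriodicConfiguration 3 => Q.energyPerParticle lennardJones) := by
  by_contra hnb
  have h0 : ePer = 0 := Real.iInf_of_not_bddBelow hnb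
  have := ePer_neg_of_starCoercivity h
  rw [h0] at this
  exact lt_irrefl _ this

/-! ## §4 Load-bearing hypothesis: injectivity (`V_LJ(0) = 0` pile-ups)

Dropping `Function.Injective x` makes the statement FALSE for every `g > 0` and every `C`:
piling `k` particles on each of the two points `0`, `e₀` gives energy `k²·V(1) = −k²/12`
against a left-hand side `≥ −2k(B + |C|)`, where `−B ≤ e_per` (a bound exists in BOTH the
genuine and the junk case, so this refutation needs no stability input). Any proof of the crux
must use injectivity (it is the only hypothesis on `x`). -/

/-- A periodic configuration of `ℝ³` exists (the simple cubic lattice), so `⨅` is over a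
non-empty type. [folklore] -/
instance : Nonempty (PeriodicConfiguration 3) :=
  ⟨Literature.Barriers.AtomisticToContinuum.bravaisConfiguration
    (Literature.Barriers.AtomisticToContinuum.cubicLattice 1) 0⟩

/-- Unconditionally `−B ≤ e_per` for some `B ≥ 0` (genuine infimum: any lower bound; junk
case: `e_per = 0`). [folklore] -/
theorem exists_neg_le_ePer : ∃ B : ℝ, 0 ≤ B ∧ -B ≤ ePer := by
  by_cases hb : BddBelow (Set.range fun Q : PeriodicConfiguration 3 =>
      Q.energyPerParticle lennardJones)
  · obtain ⟨b, hb⟩ := hb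
    refine ⟨max 0 (-b), le_max_left _ _, ?_⟩
    have : b ≤ ePer := le_ciInf fun Q => hb ⟨Q, rfl⟩
    have h2 : -max 0 (-b) ≤ b := by
      have := le_max_right 0 (-b); linarith
    exact h2.trans this
  · exact ⟨0, le_rfl, by rw [ePer, Real.iInf_of_not_bddBelow hb]; simp⟩

/-- The crux WITHOUT injectivity (otherwise verbatim). -/
def StarCoercivityNonInj : Prop :=
  ∃ g : ℝ, 0 < g ∧ ∃ C : ℝ, ∀ (N : ℕ) (x : Fin N → E3),
    (N : ℝ) * ePer + g * (defects x : ℝ) - C * (N : ℝ) ^ (2 / 3 : ℝ) ≤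
      interactionEnergy lennardJones x

/-- Two piles: `k` particles at `0` and `k` particles at `e₀`. [folklore] -/
def pile (k : ℕ) : Fin (k + k) → E3 := Fin.append (fun _ : Fin k => (0 : E3)) (fun _ : Fin k => e0)

theorem pile_apply_or (k : ℕ) (j : Fin (k + k)) : pile k j = 0 ∨ pile k j = e0 := by
  unfold pile Fin.append Fin.addCases
  by_cases h : (j : ℕ) < k <;> simp [h]

/-- `E_LJ(pile k) = −k²/12` (`V(0) = 0` on each pile, `k²` cross pairs at distance `1`).
[folklore] -/
theorem interactionEnergy_pile (k : ℕ) :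
    interactionEnergy lennardJones (pile k) = -((k : ℝ) ^ 2 / 12) := by
  unfold pile
  rw [interactionEnergy_append lennardJones lennardJones_zero]
  have h0 : interactionEnergy lennardJones (fun _ : Fin k => (0 : E3)) = 0 := by
    simp [interactionEnergy, lennardJones_zero]
  have h1 : interactionEnergy lennardJones (fun _ : Fin k => e0) = 0 := by
    simp [interactionEnergy, lennardJones_zero]
  have hd : dist (0 : E3) e0 = 1 := by rw [dist_eq_norm, zero_sub, norm_neg, norm_e0]
  rw [h0, h1, hd, lennardJones_one]
  simp [Finset.sum_const, Finset.card_univ, Fintype.card_fin]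
  ring

/-- Every rescaled shell of the two-pile configuration has at most two points. [folklore] -/
theorem card_shell_pile_le (k : ℕ) (i : Fin (k + k)) (a : ℝ) : (shell (pile k) i a).card ≤ 2 := by
  unfold shell
  have hsub : ((Finset.univ.filter fun j : Fin (k + k) => j ≠ i ∧
      dist (pile k i) (pile k j) ≤ 6 / 5).image fun j => a⁻¹ • (pile k j - pile k i)) ⊆
      {a⁻¹ • ((0 : E3) - pile k i), a⁻¹ • (e0 - pile k i)} := by
    intro v hv
    obtain ⟨j, -, rfl⟩ := Finset.mem_image.1 hv
    rcases pile_apply_or k j with h | h <;> simp [h]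
  exact (Finset.card_le_card hsub).trans (Finset.card_le_two)

theorem defects_pile (k : ℕ) : defects (pile k) = k + k :=
  defects_eq_of_forall fun i => isDefective_of_card_ne fun a _ _ => by
    have := card_shell_pile_le k i a; omega

/-- **Injectivity is load-bearing**: without it the crux is false for every `g > 0`, `C`.
[folklore] -/
theorem not_starCoercivityNonInj : ¬ StarCoercivityNonInj := by
  rintro ⟨g, hg, C, h⟩
  obtain ⟨B, hB0, hB⟩ := exists_neg_le_ePer
  set k : ℕ := ⌊24 * (B + |C|)⌋₊ + 1 with hk_def
  have hk : 24 * (B + |C|) < (k : ℝ) := by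
    rw [hk_def]; push_cast; exact Nat.lt_floor_add_one _
  have hkpos : (0 : ℝ) < k := by rw [hk_def]; positivity
  have key := h (k + k) (pile k)
  rw [defects_pile, interactionEnergy_pile] at key
  push_cast at key
  -- lower bounds for the three terms on the left
  set s : ℝ := ((k : ℝ) + k) ^ (2 / 3 : ℝ) with hs_def
  have hs0 : 0 ≤ s := Real.rpow_nonneg (by positivity) _
  have hs1 : s ≤ (k : ℝ) + k := by
    have h1k : (1 : ℝ) ≤ (k : ℝ) + k := by
      have : (1 : ℝ) ≤ k := by
        rw [hk_def]; push_cast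
        linarith [(Nat.cast_nonneg _ : (0 : ℝ) ≤ ⌊24 * (B + |C|)⌋₊)]
      linarith
    exact Real.rpow_le_self_of_one_le h1k (by norm_num)
  have hCs : -(|C| * ((k : ℝ) + k)) ≤ -(C * s) := by
    have : C * s ≤ |C| * s := mul_le_mul_of_nonneg_right (le_abs_self C) hs0
    nlinarith [abs_nonneg C]
  have hmain : -(((k : ℝ) + k) * (B + |C|)) ≤ -((k : ℝ) ^ 2 / 12) := by nlinarith
  -- `k² ≤ 24 k (B + |C|)` contradicts the choice of `k`
  nlinarith


/-- Closed form of the two-pile configuration. [folklore] -/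
theorem pile_apply (k : ℕ) (j : Fin (k + k)) : pile k j = if (j : ℕ) < k then 0 else e0 := by
  unfold pile Fin.append Fin.addCases
  by_cases h : (j : ℕ) < k <;> simp [h]

/-- `pile 1` (one particle at `0`, one at `e₀`) is injective, with energy `−1/12`. [folklore] -/
theorem pile_one_injective : Function.Injective (pile 1) := by
  intro i j hij
  have he : (0 : E3) ≠ e0 := by
    intro h
    have := congrArg (fun v : E3 => ‖v‖) h
    simp [norm_e0] at this
  rw [pile_apply, pile_apply] at hij
  have hi := i.2
  have hj := j.2
  apply Fin.ext
  by_cases h1 : (i : ℕ) < 1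
  · by_cases h2 : (j : ℕ) < 1
    · omega
    · simp only [h1, h2, if_true, if_false] at hij
      exact absurd hij he
  · by_cases h2 : (j : ℕ) < 1
    · simp only [h1, h2, if_true, if_false] at hij
      exact absurd hij.symm he
    · omega

/-! ## §5 The `g = 0` case holds with `C = 0`: `N·e_per ≤ E_LJ(x)` by periodisation

Periodise an injective `x` with the cubic lattice `Lℤ³`, `L = 2Σᵢ‖xᵢ‖ + 2`: the copies are at
mutual distances `≥ 2`, where `V_LJ ≤ 0`, so `e(periodisation) ≤ E_LJ(x)/N`, whence
`e_per ≤ E_LJ(x)/N` as soon as `e_per` is the genuine infimum (`BddBelow`).  So the whole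
content of the crux is carried by `0 < g`; and a refutation witness must be a NEAR-MINIMISER
(`0 ≤ E − N e_per < gN`), i.e. certifying it needs `e_per` from BELOW to precision `g`. -/

section Periodise

open Literature.Barriers.AtomisticToContinuum (cubicLattice cubicBasis cubicBasis_apply)

variable {N : ℕ} (x : Fin N → E3)

/-- A bound on all the norms `‖x i‖`. -/
def normBound : ℝ := ∑ i, ‖x i‖

theorem norm_le_normBound (i : Fin N) : ‖x i‖ ≤ normBound x :=
  Finset.single_le_sum (f := fun i => ‖x i‖) (fun _ _ => norm_nonneg _) (Finset.mem_univ i)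

theorem normBound_nonneg : 0 ≤ normBound x := Finset.sum_nonneg fun _ _ => norm_nonneg _

theorem norm_sub_le_two_normBound (i j : Fin N) : ‖x i - x j‖ ≤ 2 * normBound x :=
  (norm_sub_le _ _).trans (by linarith [norm_le_normBound x i, norm_le_normBound x j])

/-- The period `L = 2·Σ‖x i‖ + 2`. -/
def period : ℝ := 2 * normBound x + 2

theorem period_pos : 0 < period x := by unfold period; linarith [normBound_nonneg x]

/-- The period as a unit of `ℝ`. -/
def periodUnit : ℝˣ := Units.mk0 (period x) (period_pos x).ne'

@[simp] theorem val_periodUnit : (periodUnit x : ℝ) = period x := rfl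

/-- Coordinates of vectors of the cubic lattice `cℤ³` are integer multiples of `c`. [folklore] -/
theorem exists_int_coord_of_mem_cubicLattice (c : ℝˣ) {v : E3} (hv : v ∈ cubicLattice c)
    (j : Fin 3) : ∃ n : ℤ, v j = (c : ℝ) * n := by
  induction hv using Submodule.span_induction generalizing j with
  | mem v hv =>
    obtain ⟨i, rfl⟩ := hv
    rw [cubicBasis_apply]
    by_cases hji : j = i
    · subst hji; exact ⟨1, by simp⟩
    · exact ⟨0, by simp [hji]⟩
  | zero => exact ⟨0, by simp⟩
  | add u w _ _ hu hw =>
    obtain ⟨n, hn⟩ := hu j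
    obtain ⟨m, hm⟩ := hw j
    exact ⟨n + m, by simp [hn, hm, mul_add]⟩
  | smul a u _ hu =>
    obtain ⟨n, hn⟩ := hu j
    exact ⟨a * n, by simp [hn]; ring⟩

/-- Non-zero vectors of `cℤ³` (`c > 0`) have norm `≥ c`. [folklore] -/
theorem le_norm_of_mem_cubicLattice {c : ℝˣ} (hc : 0 < (c : ℝ)) {v : E3}
    (hv : v ∈ cubicLattice c) (hv0 : v ≠ 0) : (c : ℝ) ≤ ‖v‖ := by
  have hex : ∃ j, v j ≠ 0 := by
    by_contra hall
    push Not at hall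
    exact hv0 (PiLp.ext fun j => by simpa using hall j)
  obtain ⟨j, hj⟩ := hex
  obtain ⟨n, hn⟩ := exists_int_coord_of_mem_cubicLattice c hv j
  have hn0 : n ≠ 0 := by
    rintro rfl
    simp at hn
    exact hj hn
  have hn1 : (1 : ℝ) ≤ |(n : ℝ)| := by
    rw [← Int.cast_abs]; exact_mod_cast Int.one_le_abs hn0
  have hcoord : |v j| ≤ ‖v‖ := by
    have := PiLp.norm_apply_le v j
    simpa using this
  calc (c : ℝ) ≤ (c : ℝ) * |(n : ℝ)| := le_mul_of_one_le_right hc.le hn1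
    _ = |v j| := by rw [hn, abs_mul, abs_of_pos hc]
    _ ≤ ‖v‖ := hcoord

/-- **Periodisation** of a configuration of `N ≥ 1` points of `ℝ³` with the cubic lattice of
period `L = 2Σ‖xᵢ‖ + 2` (motif `= {xᵢ}`; distinct motif points differ by less than `L`, the
length of the shortest non-zero period). [folklore] -/
def periodise (hN : 0 < N) : PeriodicConfiguration 3 where
  lattice := cubicLattice (periodUnit x)
  discrete := inferInstance
  isZLattice := inferInstance
  motif := Finset.univ.image x
  motif_nonempty := by
    haveI : Nonempty (Fin N) := ⟨⟨0, hN⟩⟩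
    exact Finset.univ_nonempty.image x
  eq_of_sub_mem := by
    intro p hp q hq hpq
    obtain ⟨i, -, rfl⟩ := Finset.mem_image.1 hp
    obtain ⟨j, -, rfl⟩ := Finset.mem_image.1 hq
    by_contra hne
    have h1 := le_norm_of_mem_cubicLattice (c := periodUnit x) (period_pos x) hpq
      (sub_ne_zero.2 hne)
    have h2 := norm_sub_le_two_normBound x i j
    rw [val_periodUnit, period] at h1
    linarith

theorem motif_periodise (hN : 0 < N) : (periodise x hN).motif = Finset.univ.image x := rfl

/-- Points of the periodisation other than the `xⱼ` themselves are at distance `≥ 1` from every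
`xᵢ` (a non-zero period has length `≥ L = 2Σ‖xᵢ‖ + 2`). [folklore] -/
theorem one_le_dist_of_mem_points (hN : 0 < N) (i : Fin N) {y : E3}
    (hy : y ∈ (periodise x hN).points) (hyx : ∀ j, y ≠ x j) : 1 ≤ dist (x i) y := by
  obtain ⟨z, hz, g, hg, rfl⟩ := hy
  rw [motif_periodise] at hz
  obtain ⟨j, -, rfl⟩ := Finset.mem_image.1 hz
  have hg0 : g ≠ 0 := by
    rintro rfl
    exact hyx j (by simp)
  have hL : period x ≤ ‖g‖ := by
    have := le_norm_of_mem_cubicLattice (c := periodUnit x) (period_pos x) hg hg0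
    simpa using this
  rw [dist_eq_norm]
  have h1 : ‖g‖ - ‖x i - x j‖ ≤ ‖x i - (x j + g)‖ := by
    rw [show x i - (x j + g) = (x i - x j) - g by abel, ← norm_neg ((x i - x j) - g), neg_sub]
    exact norm_sub_norm_le g (x i - x j)
  have h2 := norm_sub_le_two_normBound x i j
  unfold period at hL
  linarith

variable {x}

/-- In fact they are at distance `≥ 2 > 6/5`, so they never enter a `6/5`-shell. [folklore] -/
theorem two_le_dist_of_mem_points (hN : 0 < N) (i : Fin N) {y : E3}
    (hy : y ∈ (periodise x hN).points) (hyx : ∀ j, y ≠ x j) : 2 ≤ dist (x i) y := by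
  obtain ⟨z, hz, g, hg, rfl⟩ := hy
  rw [motif_periodise] at hz
  obtain ⟨j, -, rfl⟩ := Finset.mem_image.1 hz
  have hg0 : g ≠ 0 := by
    rintro rfl
    exact hyx j (by simp)
  have hL : period x ≤ ‖g‖ := by
    have := le_norm_of_mem_cubicLattice (c := periodUnit x) (period_pos x) hg hg0
    simpa using this
  rw [dist_eq_norm]
  have h1 : ‖g‖ - ‖x i - x j‖ ≤ ‖x i - (x j + g)‖ := by
    rw [show x i - (x j + g) = (x i - x j) - g by abel, ← norm_neg ((x i - x j) - g), neg_sub]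
    exact norm_sub_norm_le g (x i - x j)
  have h2 := norm_sub_le_two_normBound x i j
  unfold period at hL
  linarith

/-- The points of the periodisation in the punctured `6/5`-ball about `xᵢ`, recentred and
rescaled, are exactly `shell x i a`: the shells "read in `P.points`" (as in
`PeriodicStarCoercivity`, item 13602) are the shells of `x`. [folklore] -/
theorem toFinset_inter_points_image (hN : 0 < N) (hx : Function.Injective x) (i : Fin N) (a : ℝ)
    (hfin : ((Metric.closedBall (x i) (6 / 5) \ {x i}) ∩ (periodise x hN).points).Finite) :
    hfin.toFinset.image (fun y => a⁻¹ • (y - x i)) = shell x i a := by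
  ext v
  simp only [Finset.mem_image, Set.Finite.mem_toFinset, Set.mem_inter_iff,
    Metric.mem_closedBall, Set.mem_singleton_iff, shell, Finset.mem_filter, Finset.mem_univ,
    true_and, Set.mem_sdiff]
  constructor
  · rintro ⟨y, ⟨⟨hyb, hys⟩, hyP⟩, rfl⟩
    have hex : ∃ j, y = x j := by
      by_contra hno
      push Not at hno
      have := two_le_dist_of_mem_points hN i hyP hno
      rw [dist_comm] at hyb
      linarith
    obtain ⟨j, rfl⟩ := hex
    exact ⟨j, ⟨fun hji => hys (by rw [hji]), by rwa [dist_comm] at hyb⟩, rfl⟩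
  · rintro ⟨j, ⟨hji, hd⟩, rfl⟩
    refine ⟨x j, ⟨⟨by rwa [dist_comm], fun h => hji (hx h)⟩, ?_⟩, rfl⟩
    exact (periodise x hN).mem_points_of_mem_motif (by
      rw [motif_periodise]; exact Finset.mem_image_of_mem x (Finset.mem_univ j))

/-- Hence the number of motif points of the periodisation failing ANY predicate that agrees with
`IsDefective x` on the `xᵢ` is `#Def(x)`. [folklore] -/
theorem card_filter_motif_periodise (hN : 0 < N) (hx : Function.Injective x) (p : E3 → Prop)
    {hdec : DecidablePred p} (hp : ∀ i, p (x i) ↔ IsDefective x i) :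
    (@Finset.filter _ p hdec (periodise x hN).motif).card = defects x := by
  rw [motif_periodise, Finset.filter_image, Finset.card_image_of_injective _ hx]
  unfold defects
  rw [Nat.card_eq_fintype_card, Fintype.card_subtype]
  congr 1
  exact Finset.filter_congr fun i _ => hp i

/-- The lattice sum at `xᵢ` over the periodisation is at most the finite site energy
`∑_{k ≠ i} V_LJ(|xᵢ − x_k|)`: the remaining terms are `≤ 0`. [folklore] -/
theorem tsum_le_siteEnergy (hx : Function.Injective x) (hN : 0 < N) (i : Fin N) :
    (∑' y : {y : E3 // y ∈ (periodise x hN).points ∧ y ≠ x i},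
        lennardJones (dist (x i) y.1)) ≤ siteEnergy lennardJones x i := by
  set P := periodise x hN with hP
  set f : {y : E3 // y ∈ P.points ∧ y ≠ x i} → ℝ := fun y => lennardJones (dist (x i) y.1)
    with hf
  have hsum : Summable f := P.summable_lennardJones_dist_three (x i)
  have hmem : ∀ k : {k // k ∈ Finset.univ.erase i}, x k.1 ∈ P.points ∧ x k.1 ≠ x i := fun k =>
    ⟨P.mem_points_of_mem_motif (by
        rw [hP, motif_periodise]; exact Finset.mem_image_of_mem x (Finset.mem_univ _)),
      hx.ne (Finset.ne_of_mem_erase k.2)⟩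
  set emb : {k // k ∈ Finset.univ.erase i} → {y : E3 // y ∈ P.points ∧ y ≠ x i} :=
    fun k => ⟨x k.1, hmem k⟩ with hemb
  have hinj : Function.Injective emb := by
    intro k l hkl
    have h1 : x k.1 = x l.1 := congrArg Subtype.val hkl
    exact Subtype.ext (hx h1)
  set s₀ : Finset {y : E3 // y ∈ P.points ∧ y ≠ x i} := (Finset.univ.erase i).attach.image emb
    with hs₀
  have hsign : ∀ y ∉ s₀, 0 ≤ (fun b => -f b) y := by
    intro y hy
    have hfar : ∀ j, y.1 ≠ x j := by
      intro j hj
      by_cases hji : j = i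
      · exact y.2.2 (hji ▸ hj)
      · exact hy (Finset.mem_image.2 ⟨⟨j, Finset.mem_erase.2 ⟨hji, Finset.mem_univ j⟩⟩,
          Finset.mem_attach _ _, Subtype.ext hj.symm⟩)
    have h1 := one_le_dist_of_mem_points x hN i y.2.1 hfar
    simp only [hf, neg_nonneg]
    exact lennardJones_nonpos h1
  have h1 := sum_le_hasSum s₀ hsign hsum.hasSum.neg
  have h2 : ∑ y ∈ s₀, f y = siteEnergy lennardJones x i := by
    rw [hs₀, Finset.sum_image fun k _ l _ h => hinj h]
    exact Finset.sum_attach (Finset.univ.erase i) fun k => lennardJones (dist (x i) (x k))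
  rw [Finset.sum_neg_distrib, h2] at h1
  linarith

/-- Hence `e(periodisation of x) ≤ E_LJ(x)/N`. [folklore] -/
theorem energyPerParticle_periodise_le (hx : Function.Injective x) (hN : 0 < N) :
    (periodise x hN).energyPerParticle lennardJones ≤ interactionEnergy lennardJones x / N := by
  have hcard : (periodise x hN).motif.card = N := by
    rw [motif_periodise, Finset.card_image_of_injective _ hx, Finset.card_univ, Fintype.card_fin]
  have hNr : (0 : ℝ) < N := by exact_mod_cast hN
  unfold PeriodicConfiguration.energyPerParticle
  rw [hcard]
  have hsum : ∑ z ∈ (periodise x hN).motif,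
      ∑' y : {y : E3 // y ∈ (periodise x hN).points ∧ y ≠ z}, lennardJones (dist z y.1) ≤
        ∑ i, siteEnergy lennardJones x i := by
    rw [motif_periodise, Finset.sum_image fun i _ j _ h => hx h]
    exact Finset.sum_le_sum fun i _ => tsum_le_siteEnergy hx hN i
  rw [← two_mul_interactionEnergy] at hsum
  calc (2 * (N : ℝ))⁻¹ * ∑ z ∈ (periodise x hN).motif,
        ∑' y : {y : E3 // y ∈ (periodise x hN).points ∧ y ≠ z}, lennardJones (dist z y.1)
      ≤ (2 * (N : ℝ))⁻¹ * (2 * interactionEnergy lennardJones x) :=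
        mul_le_mul_of_nonneg_left hsum (by positivity)
    _ = interactionEnergy lennardJones x / N := by
        field_simp

end Periodise

/-- **`N·e_per ≤ E_LJ(x)` for every injective configuration** (given that `e_per` is the genuine
infimum): the `g = 0`, `C = 0` instance of the crux. [folklore] -/
theorem card_mul_ePer_le_interactionEnergy
    (hB : BddBelow (Set.range fun Q : PeriodicConfiguration 3 => Q.energyPerParticle lennardJones))
    {N : ℕ} {x : Fin N → E3} (hx : Function.Injective x) :
    (N : ℝ) * ePer ≤ interactionEnergy lennardJones x := by
  rcases Nat.eq_zero_or_pos N with rfl | hN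
  · simp [interactionEnergy]
  · have h1 : ePer ≤ (periodise x hN).energyPerParticle lennardJones := ciInf_le hB _
    have h2 := energyPerParticle_periodise_le hx hN
    have hNr : (0 : ℝ) < N := by exact_mod_cast hN
    have := h1.trans h2
    rwa [le_div_iff₀ hNr, mul_comm] at this

/-- `StarCoercivityWith 0 0` holds as soon as `e_per` is a genuine infimum. [folklore] -/
theorem starCoercivityWith_zero_zero
    (hB : BddBelow (Set.range fun Q : PeriodicConfiguration 3 => Q.energyPerParticle lennardJones)) :
    StarCoercivityWith 0 0 := fun N x hx => by
  simpa using card_mul_ePer_le_interactionEnergy hB hx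

/-- … and ONLY then: in the junk case `e_per = 0` the dimer `pile 1` has energy `−1/12 < 0`.
So `StarCoercivityWith 0 0 ↔ BddBelow`. [folklore] -/
theorem starCoercivityWith_zero_zero_iff :
    StarCoercivityWith 0 0 ↔
      BddBelow (Set.range fun Q : PeriodicConfiguration 3 => Q.energyPerParticle lennardJones) := by
  refine ⟨fun h => ?_, starCoercivityWith_zero_zero⟩
  by_contra hnb
  have h0 : ePer = 0 := Real.iInf_of_not_bddBelow hnb
  have key := h (1 + 1) (pile 1) pile_one_injective
  rw [interactionEnergy_pile, h0] at key
  norm_num at key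

/-- **The obstruction to a cheap refutation, formally.** Granted the genuine infimum, a witness
against `StarCoercivityWith g C` (`g ≥ 0`) is a configuration whose excess energy
`E_LJ(x) − N·e_per` lies in `[0, gN − C N^(2/3))`: a near-minimiser with positive defect
density. Certifying `E_LJ(x) − N·e_per < gN` requires a LOWER bound on `e_per` sharp to
precision `g` — the energetic crystallization bound itself. [folklore] -/
theorem nearMinimiser_of_violation
    (hB : BddBelow (Set.range fun Q : PeriodicConfiguration 3 => Q.energyPerParticle lennardJones))
    {g C : ℝ} (hg : 0 ≤ g) {N : ℕ} {x : Fin N → E3} (hx : Function.Injective x)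
    (hviol : interactionEnergy lennardJones x <
      (N : ℝ) * ePer + g * (defects x : ℝ) - C * (N : ℝ) ^ (2 / 3 : ℝ)) :
    0 ≤ interactionEnergy lennardJones x - (N : ℝ) * ePer ∧
      interactionEnergy lennardJones x - (N : ℝ) * ePer < g * N - C * (N : ℝ) ^ (2 / 3 : ℝ) := by
  refine ⟨by linarith [card_mul_ePer_le_interactionEnergy hB hx], ?_⟩
  have hd : (defects x : ℝ) ≤ N := by exact_mod_cast defects_le x
  nlinarith [mul_le_mul_of_nonneg_left hd hg]

/-- Unfolded negation of the crux (for ideators): to refute, produce for EVERY `g > 0` and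
EVERY `C` an injective configuration violating the inequality. [folklore] -/
theorem not_starCoercivity_iff :
    ¬ StarCoercivity ↔ ∀ g : ℝ, 0 < g → ∀ C : ℝ, ∃ (N : ℕ) (x : Fin N → E3),
      Function.Injective x ∧ interactionEnergy lennardJones x <
        (N : ℝ) * ePer + g * (defects x : ℝ) - C * (N : ℝ) ^ (2 / 3 : ℝ) := by
  rw [starCoercivity_iff]
  simp only [StarCoercivityWith, not_exists, not_and, not_forall, not_le]
  exact ⟨fun h g hg C => by simpa using h g hg C, fun h g hg C => by simpa using h g hg C⟩

/-- A countable normal form: the crux holds iff some `(g, C) = (1/(n+1), n+1)` works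
(monotonicity). [folklore] -/
theorem starCoercivity_iff_nat :
    StarCoercivity ↔ ∃ n : ℕ, StarCoercivityWith (1 / ((n : ℝ) + 1)) ((n : ℝ) + 1) := by
  rw [starCoercivity_iff]
  constructor
  · rintro ⟨g, hg, C, h⟩
    obtain ⟨n₁, hn₁⟩ := exists_nat_one_div_lt hg
    obtain ⟨n₂, hn₂⟩ := exists_nat_ge C
    refine ⟨n₁ + n₂, h.mono ?_ ?_⟩
    · have h1 : (1 : ℝ) / ((n₁ : ℝ) + 1) ≥ 1 / (((n₁ + n₂ : ℕ) : ℝ) + 1) := by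
        apply one_div_le_one_div_of_le (by positivity)
        push_cast; linarith [(Nat.cast_nonneg n₂ : (0 : ℝ) ≤ n₂)]
      linarith
    · push_cast; linarith [(Nat.cast_nonneg n₁ : (0 : ℝ) ≤ n₁)]
  · rintro ⟨n, h⟩
    exact ⟨1 / ((n : ℝ) + 1), by positivity, (n : ℝ) + 1, h⟩


/-! ## §6 Non-vacuity of the defect predicate (junk-model check)

If NO site of ANY configuration could pass the shell test, `#Def = N` identically and the crux
would say `e_∞ ≥ e_per + g`, which is false; so a refuter must check that free sites exist AS
TYPED (pattern scale, bijection, linear isometry, `a`-window).  They do: the centres of the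
13-point clusters `{0} ∪ fccKissingPattern` and `{0} ∪ hcpKissingPattern` are free with `a = 1`,
`A = id` (one per disjunct). -/

section PatternCluster

variable (P : Finset E3) (h12 : P.card = 12) (hnorm : ∀ v ∈ P, ‖v‖ = 1)

/-- An enumeration of a twelve-point pattern. -/
def patternEnum : Fin 12 ≃ {v : E3 // v ∈ P} := (Finset.equivFinOfCardEq h12).symm

/-- The 13-point cluster: the origin followed by the twelve pattern points. -/
def patternCluster : Fin (12 + 1) → E3 := Fin.cons 0 fun k => (patternEnum P h12 k).1

@[simp] theorem patternCluster_zero : patternCluster P h12 0 = 0 := by simp [patternCluster]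

@[simp] theorem patternCluster_succ (k : Fin 12) :
    patternCluster P h12 k.succ = (patternEnum P h12 k).1 := by
  simp [patternCluster]

include hnorm in
theorem norm_patternCluster_succ (k : Fin 12) : ‖patternCluster P h12 k.succ‖ = 1 := by
  rw [patternCluster_succ]
  exact hnorm _ (patternEnum P h12 k).2

include hnorm in
theorem patternCluster_injective : Function.Injective (patternCluster P h12) := by
  intro i j hij
  induction i using Fin.cases with
  | zero =>
    induction j using Fin.cases with
    | zero => rfl
    | succ b =>
      exfalso
      have h := norm_patternCluster_succ P h12 hnorm b
      rw [← hij, patternCluster_zero, norm_zero] at h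
      exact zero_ne_one h
  | succ a =>
    induction j using Fin.cases with
    | zero =>
      exfalso
      have h := norm_patternCluster_succ P h12 hnorm a
      rw [hij, patternCluster_zero, norm_zero] at h
      exact zero_ne_one h
    | succ b =>
      rw [patternCluster_succ, patternCluster_succ] at hij
      have : patternEnum P h12 a = patternEnum P h12 b := Subtype.ext hij
      rw [(patternEnum P h12).injective this]

include hnorm in
/-- At scale `a = 1` the shell of the centre IS the pattern. [folklore] -/
theorem shell_patternCluster_zero : shell (patternCluster P h12) 0 1 = P := by
  ext v
  simp only [shell, inv_one, one_smul, patternCluster_zero, sub_zero, Finset.mem_image,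
    Finset.mem_filter, Finset.mem_univ, true_and]
  constructor
  · rintro ⟨j, ⟨hj0, -⟩, rfl⟩
    obtain ⟨k, rfl⟩ := Fin.exists_succ_eq.2 hj0
    rw [patternCluster_succ]
    exact (patternEnum P h12 k).2
  · intro hv
    refine ⟨((patternEnum P h12).symm ⟨v, hv⟩).succ, ⟨Fin.succ_ne_zero _, ?_⟩, ?_⟩
    · rw [dist_eq_norm, zero_sub, norm_neg, norm_patternCluster_succ P h12 hnorm]; norm_num
    · rw [patternCluster_succ, Equiv.apply_symm_apply]

include hnorm in
/-- The centre is not `P`-defective: its shell is `1/20`-close to `P` (indeed equal). -/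
theorem shellCloseTo_patternCluster_zero :
    ShellCloseTo (1 / 20) (shell (patternCluster P h12) 0 1) P := by
  rw [shell_patternCluster_zero P h12 hnorm]
  exact ShellCloseTo.refl (by norm_num) _

end PatternCluster

/-- The 13-point fcc cluster `{0} ∪ fccKissingPattern` (cuboctahedron + centre). -/
def fccCluster : Fin (12 + 1) → E3 := patternCluster fccKissingPattern card_fccKissingPattern

/-- The 13-point hcp cluster `{0} ∪ hcpKissingPattern` (anticuboctahedron + centre). -/
def hcpCluster : Fin (12 + 1) → E3 := patternCluster hcpKissingPattern card_hcpKissingPattern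

theorem fccCluster_injective : Function.Injective fccCluster :=
  patternCluster_injective _ _ fun _ hv => norm_eq_one_of_mem_fccKissingPattern hv

theorem hcpCluster_injective : Function.Injective hcpCluster :=
  patternCluster_injective _ _ fun _ hv => norm_eq_one_of_mem_hcpKissingPattern hv

/-- **The centre of the fcc cluster is a free (non-defective) site** (`a = 1`, first disjunct).
[folklore] -/
theorem not_isDefective_fccCluster_zero : ¬ IsDefective fccCluster 0 := by
  intro h
  apply h
  exact ⟨1, by norm_num, by norm_num, Or.inl
    (shellCloseTo_patternCluster_zero _ _ fun _ hv => norm_eq_one_of_mem_fccKissingPattern hv)⟩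

/-- **The centre of the hcp cluster is a free site** (`a = 1`, second disjunct). [folklore] -/
theorem not_isDefective_hcpCluster_zero : ¬ IsDefective hcpCluster 0 := by
  intro h
  apply h
  exact ⟨1, by norm_num, by norm_num, Or.inr
    (shellCloseTo_patternCluster_zero _ _ fun _ hv => norm_eq_one_of_mem_hcpKissingPattern hv)⟩

/-- Hence free sites exist as typed (through either disjunct), and `#Def < N` happens.
[folklore] -/
theorem exists_free_site :
    ∃ (N : ℕ) (x : Fin N → E3) (i : Fin N), Function.Injective x ∧ ¬ IsDefective x i :=
  ⟨12 + 1, fccCluster, 0, fccCluster_injective, not_isDefective_fccCluster_zero⟩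

theorem defects_fccCluster_lt : defects fccCluster < 12 + 1 := by
  unfold defects
  rw [Nat.card_eq_fintype_card]
  calc Fintype.card {i : Fin (12 + 1) // IsDefective fccCluster i} < Fintype.card (Fin (12 + 1)) :=
        Fintype.card_subtype_lt not_isDefective_fccCluster_zero
    _ = 12 + 1 := Fintype.card_fin _

theorem defects_hcpCluster_lt : defects hcpCluster < 12 + 1 := by
  unfold defects
  rw [Nat.card_eq_fintype_card]
  calc Fintype.card {i : Fin (12 + 1) // IsDefective hcpCluster i} < Fintype.card (Fin (12 + 1)) :=
        Fintype.card_subtype_lt not_isDefective_hcpCluster_zero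
    _ = 12 + 1 := Fintype.card_fin _

/-! ## §7 Where the content sits: slack `o(N)` versus `O(N)`

With a slack LINEAR in `N` the statement is a theorem NOW (finite stability
`lennardJones_stable_holds` in the junk case, periodisation in the genuine case), for trivial
reasons (`#Def ≤ N`).  So the sublinear exponent `2/3` — any `o(N)` slack — is exactly where
the crux acquires content; the boundary allowance itself is not the difficulty. -/

/-- The crux with slack `C·N` instead of `C·N^(2/3)`. -/
def StarCoercivityLinearSlack : Prop :=
  ∃ g : ℝ, 0 < g ∧ ∃ C : ℝ, ∀ (N : ℕ) (x : Fin N → E3), Function.Injective x →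
    (N : ℝ) * ePer + g * (defects x : ℝ) - C * (N : ℝ) ≤ interactionEnergy lennardJones x

/-- **Linear slack trivialises the crux** (unconditionally). [folklore] -/
theorem starCoercivityLinearSlack : StarCoercivityLinearSlack := by
  by_cases hB : BddBelow (Set.range fun Q : PeriodicConfiguration 3 =>
      Q.energyPerParticle lennardJones)
  · refine ⟨1, one_pos, 1, fun N x hx => ?_⟩
    have h1 := card_mul_ePer_le_interactionEnergy hB hx
    have hd : (defects x : ℝ) ≤ N := by exact_mod_cast defects_le x
    linarith
  · have h0 : ePer = 0 := Real.iInf_of_not_bddBelow hB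
    obtain ⟨B, hBst⟩ := lennardJones_stable_holds 3 (by norm_num)
    refine ⟨1, one_pos, 1 + max B 0, fun N x hx => ?_⟩
    have h1 := hBst N x hx
    have hd : (defects x : ℝ) ≤ N := by exact_mod_cast defects_le x
    have hN : (0 : ℝ) ≤ N := Nat.cast_nonneg N
    rw [h0]
    nlinarith [le_max_left B 0, le_max_right B 0]


/-! ## §8 The boundary allowance is redundant: `StarCoercivityWith g C → StarCoercivityWith g 0`

Self-similarity kills the `C·N^(2/3)` term at the level of the STATEMENT.  If some `x` violated
the `C = 0` inequality by `Δ > 0`, then `K` translated copies of `x` (spacing `L = 2Σ‖xᵢ‖ + 2`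
along `e₀`) form an injective configuration with `K·N` points, EXACTLY `K·#Def(x)` defective
sites (shells have radius `6/5 < 2 ≤` the distance between copies) and energy `≤ K·E_LJ(x)`
(cross terms `≤ 0`), so it violates the `(g, C)` inequality by `KΔ − C(KN)^(2/3) → +∞`.
No periodic configurations, no knowledge of `e_per` (it enters linearly on both sides, genuine
or junk), no stability.  Consequences: `starCoercivity_iff_zero_slack` (the crux is its own
`C = 0` form; cf. the planners' "no separate boundary term is expected"), and §3's vacuum
tightness is just the case `N = 1` of the `C = 0` form. -/

section Reindex

variable {ι : Type*} [Fintype ι]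

/-- Shell of a site for a configuration indexed by an arbitrary finite type. -/
def shellOn (y : ι → E3) (a : ι) (c : ℝ) : Finset E3 :=
  (Finset.univ.filter fun b : ι => b ≠ a ∧ dist (y a) (y b) ≤ 6 / 5).image fun b => c⁻¹ • (y b - y a)

/-- Defectiveness for a configuration indexed by an arbitrary finite type. -/
def IsDefectiveOn (y : ι → E3) (a : ι) : Prop :=
  ¬ ∃ c : ℝ, 9 / 10 ≤ c ∧ c ≤ 11 / 10 ∧
    (ShellCloseTo (1 / 20) (shellOn y a c) fccKissingPattern ∨
     ShellCloseTo (1 / 20) (shellOn y a c) hcpKissingPattern)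

/-- Defect count for a configuration indexed by an arbitrary finite type. -/
def defectsOn (y : ι → E3) : ℕ := Nat.card {a : ι // IsDefectiveOn y a}

variable {n : ℕ} (e : Fin n ≃ ι) (y : ι → E3)

theorem shell_comp_equiv (i : Fin n) (c : ℝ) : shell (y ∘ e) i c = shellOn y (e i) c := by
  ext v
  simp only [shell, shellOn, Finset.mem_image, Finset.mem_filter, Finset.mem_univ, true_and,
    Function.comp_apply]
  constructor
  · rintro ⟨j, ⟨hj, hd⟩, rfl⟩
    exact ⟨e j, ⟨fun h => hj (e.injective h), hd⟩, rfl⟩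
  · rintro ⟨b, ⟨hb, hd⟩, rfl⟩
    refine ⟨e.symm b, ⟨fun h => hb ?_, by simpa using hd⟩, by simp⟩
    rw [← h, Equiv.apply_symm_apply]

theorem isDefective_comp_equiv (i : Fin n) : IsDefective (y ∘ e) i ↔ IsDefectiveOn y (e i) := by
  simp only [IsDefective, IsDefectiveOn, shell_comp_equiv]

theorem defects_comp_equiv : defects (y ∘ e) = defectsOn y := by
  unfold defects defectsOn
  exact Nat.card_congr (e.subtypeEquiv fun i => isDefective_comp_equiv e y i)

theorem two_mul_interactionEnergy_comp_equiv :
    2 * interactionEnergy lennardJones (y ∘ e) = ∑ a, ∑ b, lennardJones (dist (y a) (y b)) := by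
  rw [two_mul_interactionEnergy_eq_sum_sum lennardJones lennardJones_zero]
  simp only [Function.comp_apply]
  calc ∑ i, ∑ j, lennardJones (dist (y (e i)) (y (e j)))
      = ∑ i, ∑ b, lennardJones (dist (y (e i)) (y b)) :=
        Finset.sum_congr rfl fun i _ => Equiv.sum_comp e (fun b => lennardJones (dist (y (e i)) (y b)))
    _ = ∑ a, ∑ b, lennardJones (dist (y a) (y b)) :=
        Equiv.sum_comp e (fun a => ∑ b, lennardJones (dist (y a) (y b)))

end Reindex

section Copies

variable {N : ℕ} (x : Fin N → E3)

/-- `K` translated copies of `x`, spacing `period x` along `e₀`, on the product index type. -/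
def copies' (K : ℕ) : Fin K × Fin N → E3 := fun a => x a.2 + (period x * ((a.1 : ℕ) : ℝ)) • e0

/-- The same configuration re-indexed by `Fin (K·N)`. -/
def copies (K : ℕ) : Fin (K * N) → E3 := copies' x K ∘ finProdFinEquiv.symm

theorem dist_copies'_of_fst_eq (K : ℕ) {a b : Fin K × Fin N} (h : a.1 = b.1) :
    dist (copies' x K a) (copies' x K b) = dist (x a.2) (x b.2) := by
  simp only [copies', h, dist_add_right]

theorem sub_copies'_of_fst_eq (K : ℕ) {a b : Fin K × Fin N} (h : a.1 = b.1) :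
    copies' x K b - copies' x K a = x b.2 - x a.2 := by
  simp only [copies', h]; abel

theorem two_le_dist_copies'_of_fst_ne (K : ℕ) {a b : Fin K × Fin N} (h : a.1 ≠ b.1) :
    2 ≤ dist (copies' x K a) (copies' x K b) := by
  set u : E3 := x a.2 - x b.2 with hu
  set w : E3 := (period x * ((a.1 : ℕ) : ℝ) - period x * ((b.1 : ℕ) : ℝ)) • e0 with hw
  have hdist : dist (copies' x K a) (copies' x K b) = ‖u + w‖ := by
    rw [dist_eq_norm, hu, hw]
    congr 1
    simp only [copies', sub_smul]
    abel
  have hne : ((a.1 : ℕ) : ℝ) ≠ ((b.1 : ℕ) : ℝ) := by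
    intro h'; exact h (Fin.ext (by exact_mod_cast h'))
  have h1 : (1 : ℝ) ≤ |((a.1 : ℕ) : ℝ) - ((b.1 : ℕ) : ℝ)| := by
    rcases lt_or_gt_of_ne hne with hlt | hlt
    · have : ((a.1 : ℕ) : ℝ) + 1 ≤ ((b.1 : ℕ) : ℝ) := by exact_mod_cast (show (a.1 : ℕ) < b.1 by exact_mod_cast hlt)
      rw [abs_of_neg (by linarith)]; linarith
    · have : ((b.1 : ℕ) : ℝ) + 1 ≤ ((a.1 : ℕ) : ℝ) := by exact_mod_cast (show (b.1 : ℕ) < a.1 by exact_mod_cast hlt)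
      rw [abs_of_pos (by linarith)]; linarith
  have hwn : period x ≤ ‖w‖ := by
    rw [hw, norm_smul, norm_e0, mul_one, ← mul_sub, Real.norm_eq_abs, abs_mul,
      abs_of_pos (period_pos x)]
    exact le_mul_of_one_le_right (period_pos x).le h1
  have hun : ‖u‖ ≤ 2 * normBound x := norm_sub_le_two_normBound x a.2 b.2
  have htri : ‖w‖ - ‖u‖ ≤ ‖u + w‖ := by
    have := norm_sub_le (u + w) u
    rw [add_sub_cancel_left] at this
    linarith
  rw [hdist]
  unfold period at hwn
  linarith

variable {x}

theorem copies'_injective (hx : Function.Injective x) (K : ℕ) : Function.Injective (copies' x K) := by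
  intro a b hab
  by_cases h : a.1 = b.1
  · have h2 : x a.2 = x b.2 := by
      have := sub_copies'_of_fst_eq x K h
      rw [hab, sub_self] at this
      exact (sub_eq_zero.1 this.symm).symm
    exact Prod.ext h (hx h2)
  · exfalso
    have := two_le_dist_copies'_of_fst_ne x K h
    rw [hab, dist_self] at this
    linarith

theorem copies_injective (hx : Function.Injective x) (K : ℕ) : Function.Injective (copies x K) :=
  (copies'_injective hx K).comp finProdFinEquiv.symm.injective

/-- Shells of the copies are the shells of `x` (other copies are `≥ 2 > 6/5` away). [folklore] -/
theorem shellOn_copies' (K : ℕ) (a : Fin K × Fin N) (c : ℝ) :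
    shellOn (copies' x K) a c = shell x a.2 c := by
  ext v
  simp only [shellOn, shell, Finset.mem_image, Finset.mem_filter, Finset.mem_univ, true_and]
  constructor
  · rintro ⟨b, ⟨hb, hd⟩, rfl⟩
    have h1 : a.1 = b.1 := by
      by_contra hne
      have := two_le_dist_copies'_of_fst_ne x K hne
      linarith
    refine ⟨b.2, ⟨fun h2 => hb (Prod.ext h1.symm h2), ?_⟩, ?_⟩
    · rwa [dist_copies'_of_fst_eq x K h1] at hd
    · rw [sub_copies'_of_fst_eq x K h1]
  · rintro ⟨j, ⟨hj, hd⟩, rfl⟩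
    refine ⟨(a.1, j), ⟨fun h2 => hj (congrArg Prod.snd h2), ?_⟩, ?_⟩
    · rwa [dist_copies'_of_fst_eq x K (a := a) (b := (a.1, j)) rfl]
    · rw [sub_copies'_of_fst_eq x K (a := a) (b := (a.1, j)) rfl]

theorem isDefectiveOn_copies' (K : ℕ) (a : Fin K × Fin N) :
    IsDefectiveOn (copies' x K) a ↔ IsDefective x a.2 := by
  simp only [IsDefectiveOn, IsDefective, shellOn_copies']

/-- The copies have exactly `K·#Def(x)` defective sites. [folklore] -/
theorem defects_copies (K : ℕ) : defects (copies x K) = K * defects x := by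
  rw [copies, defects_comp_equiv]
  unfold defectsOn defects
  have e1 : {a : Fin K × Fin N // IsDefectiveOn (copies' x K) a} ≃
      Fin K × {i : Fin N // IsDefective x i} :=
    (Equiv.subtypeEquivRight fun a => isDefectiveOn_copies' K a).trans
      { toFun := fun a => (a.1.1, ⟨a.1.2, a.2⟩)
        invFun := fun b => ⟨(b.1, b.2.1), b.2.2⟩
        left_inv := fun a => rfl
        right_inv := fun b => rfl }
  rw [Nat.card_congr e1, Nat.card_prod]
  simp

/-- The energy of the copies is at most `K·E_LJ(x)` (cross terms are `≤ 0`). [folklore] -/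
theorem interactionEnergy_copies_le (K : ℕ) :
    interactionEnergy lennardJones (copies x K) ≤ K * interactionEnergy lennardJones x := by
  have h2 := two_mul_interactionEnergy_comp_equiv finProdFinEquiv.symm (copies' x K)
  rw [← copies] at h2
  -- bound each inner sum by its same-copy part
  have hinner : ∀ a : Fin K × Fin N, ∑ b, lennardJones (dist (copies' x K a) (copies' x K b)) ≤
      ∑ j, lennardJones (dist (x a.2) (x j)) := by
    intro a
    rw [← Finset.sum_filter_add_sum_filter_not Finset.univ (fun b : Fin K × Fin N => b.1 = a.1)]
    have hneg : ∑ b ∈ Finset.univ.filter (fun b : Fin K × Fin N => ¬ b.1 = a.1),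
        lennardJones (dist (copies' x K a) (copies' x K b)) ≤ 0 := by
      refine Finset.sum_nonpos fun b hb => ?_
      have hb' : a.1 ≠ b.1 := fun h => (Finset.mem_filter.1 hb).2 h.symm
      exact lennardJones_nonpos (by linarith [two_le_dist_copies'_of_fst_ne x K hb'])
    have hpos : ∑ b ∈ Finset.univ.filter (fun b : Fin K × Fin N => b.1 = a.1),
        lennardJones (dist (copies' x K a) (copies' x K b)) = ∑ j, lennardJones (dist (x a.2) (x j)) := by
      have hset : Finset.univ.filter (fun b : Fin K × Fin N => b.1 = a.1) =
          (Finset.univ : Finset (Fin N)).map ⟨fun j => (a.1, j), fun j j' h => congrArg Prod.snd h⟩ := by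
        ext b
        simp only [Finset.mem_filter, Finset.mem_univ, true_and, Finset.mem_map,
          Function.Embedding.coeFn_mk]
        constructor
        · intro hb; exact ⟨b.2, by rw [← hb]⟩
        · rintro ⟨j, rfl⟩; rfl
      rw [hset, Finset.sum_map]
      refine Finset.sum_congr rfl fun j _ => ?_
      simp only [Function.Embedding.coeFn_mk]
      rw [dist_copies'_of_fst_eq x K (a := a) (b := (a.1, j)) rfl]
    linarith
  have htot : ∑ a : Fin K × Fin N, ∑ b, lennardJones (dist (copies' x K a) (copies' x K b)) ≤
      (K : ℝ) * (2 * interactionEnergy lennardJones x) := by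
    calc ∑ a : Fin K × Fin N, ∑ b, lennardJones (dist (copies' x K a) (copies' x K b))
        ≤ ∑ a : Fin K × Fin N, ∑ j, lennardJones (dist (x a.2) (x j)) := Finset.sum_le_sum fun a _ => hinner a
      _ = ∑ k : Fin K, ∑ i : Fin N, ∑ j, lennardJones (dist (x i) (x j)) := Fintype.sum_prod_type _
      _ = (K : ℝ) * (2 * interactionEnergy lennardJones x) := by
          rw [two_mul_interactionEnergy_eq_sum_sum lennardJones lennardJones_zero, Finset.sum_const,
            Finset.card_univ, Fintype.card_fin, nsmul_eq_mul]
  linarith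

end Copies

/-- **The boundary allowance is redundant.** [folklore] -/
theorem StarCoercivityWith.zero_slack {g C : ℝ} (h : StarCoercivityWith g C) : StarCoercivityWith g 0 := by
  intro N x hx
  by_contra hviol
  push Not at hviol
  simp only [zero_mul, sub_zero] at hviol
  set Δ : ℝ := (N : ℝ) * ePer + g * (defects x : ℝ) - interactionEnergy lennardJones x with hΔ_def
  have hΔ : 0 < Δ := by rw [hΔ_def]; linarith
  set t : ℝ := (N : ℝ) ^ (2 / 3 : ℝ) with ht_def
  have ht : 0 ≤ t := Real.rpow_nonneg (Nat.cast_nonneg N) _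
  -- `K = M³` copies with `M·Δ > |C|·t`
  obtain ⟨M, hM⟩ := exists_nat_gt (|C| * t / Δ)
  have hMpos : (0 : ℝ) < M := lt_of_le_of_lt (by positivity) hM
  have key := h (M ^ 3 * N) (copies x (M ^ 3)) (copies_injective hx _)
  rw [defects_copies] at key
  have hE := interactionEnergy_copies_le (x := x) (M ^ 3)
  have hrpow : (((M ^ 3 * N : ℕ) : ℝ)) ^ (2 / 3 : ℝ) = (M : ℝ) ^ 2 * t := by
    push_cast
    rw [Real.mul_rpow (by positivity) (Nat.cast_nonneg N), cube_rpow_two_thirds]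
  rw [hrpow] at key
  push_cast at key hE
  -- `M³·Δ ≤ C·M²·t ≤ |C|·M²·t`
  have h1 : (M : ℝ) ^ 3 * Δ ≤ C * ((M : ℝ) ^ 2 * t) := by rw [hΔ_def]; nlinarith
  have h2 : C * ((M : ℝ) ^ 2 * t) ≤ |C| * ((M : ℝ) ^ 2 * t) :=
    mul_le_mul_of_nonneg_right (le_abs_self C) (by positivity)
  have h3 : (M : ℝ) * Δ ≤ |C| * t := by
    have hM2 : (0 : ℝ) < (M : ℝ) ^ 2 := by positivity
    have : (M : ℝ) * Δ * (M : ℝ) ^ 2 ≤ |C| * t * (M : ℝ) ^ 2 := by nlinarith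
    exact le_of_mul_le_mul_right this hM2
  have h4 : |C| * t < (M : ℝ) * Δ := by rwa [div_lt_iff₀ hΔ] at hM
  linarith

/-- Hence the crux is equivalent to its `C = 0` form. [folklore] -/
theorem starCoercivity_iff_zero_slack : StarCoercivity ↔ ∃ g : ℝ, 0 < g ∧ StarCoercivityWith g 0 := by
  rw [starCoercivity_iff]
  exact ⟨fun ⟨g, hg, C, h⟩ => ⟨g, hg, h.zero_slack⟩, fun ⟨g, hg, h⟩ => ⟨g, hg, 0, h⟩⟩

/-- … and the vacuum tightness of §3 is the one-particle case of the `C = 0` form: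
`e_per + g ≤ E_LJ(single point) = 0`. [folklore] -/
theorem g_le_neg_ePer' {g C : ℝ} (h : StarCoercivityWith g C) : g ≤ -ePer := by
  have key := h.zero_slack 1 (lineConfig 1) (lineConfig_injective 1)
  rw [defects_lineConfig] at key
  have hE : interactionEnergy lennardJones (lineConfig 1) = 0 :=
    interactionEnergy_of_subsingleton lennardJones _
  rw [hE] at key
  norm_num at key
  linarith


/-! ## §9 `PeriodicStarCoercivity` (13602) implies the crux — with `C = 0`

The periodisation of §5 has period `> diam + 6/5`, so its shells read in `P.points` are the
shells of `x` (`toFinset_inter_points_image`) and its defect fraction is `#Def(x)/N`, while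
`e(P) ≤ E_LJ(x)/N`.  Feeding it to 13602 gives `N·e_per + g·#Def(x) ≤ E_LJ(x)`.  (The
planners' crux note states this with a `sorry`; here it is closed.)  For the adversary this
means: a refutation of the crux refutes 13602 as well, and explicit PERIODIC competitors are
legitimate test objects for 13600. -/

open Summit.AtomisticToContinuum.Crystallization.Theses.ReggeStarCoercivity (PeriodicStarCoercivity) in
/-- **13602 ⇒ 13600** (and the implication lands in the `C = 0` form). [folklore] -/
theorem starCoercivity_of_periodicStarCoercivity (h : PeriodicStarCoercivity) : StarCoercivity := by
  obtain ⟨g, hg, hP⟩ := h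
  refine starCoercivity_iff_zero_slack.2 ⟨g, hg, fun N x hx => ?_⟩
  simp only [zero_mul, sub_zero]
  rcases Nat.eq_zero_or_pos N with rfl | hN
  · have hd : defects x = 0 := by have := defects_le x; omega
    simp [interactionEnergy, hd]
  · have key := hP (periodise x hN)
    rw [card_filter_motif_periodise hN hx _ (fun i => ?_)] at key
    · have hcardm : (((periodise x hN).motif.card : ℕ) : ℝ) = N := by
        rw [motif_periodise, Finset.card_image_of_injective _ hx]
        simp
      rw [hcardm] at key
      have h2 := energyPerParticle_periodise_le hx hN
      have hNr : (0 : ℝ) < N := by exact_mod_cast hN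
      have h3 : ePer + g * (defects x : ℝ) / N ≤ interactionEnergy lennardJones x / N :=
        key.trans h2
      calc (N : ℝ) * ePer + g * (defects x : ℝ) = (ePer + g * (defects x : ℝ) / N) * N := by
            field_simp
        _ ≤ interactionEnergy lennardJones x / N * N := mul_le_mul_of_nonneg_right h3 hNr.le
        _ = interactionEnergy lennardJones x := by field_simp
    · simp only [toFinset_inter_points_image hN hx i, IsDefective]


/-- Explicit all-defective clusters cap `g` relative to `e_per` through the `C = 0` form; e.g. the
unit dimer (`pile 1`: two defective sites, energy `−1/12`) gives `g ≤ −e_per − 1/24`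
(numerically `0.676`; the 13-atom icosahedron gives `0.43`, bulk competitors `≲ 6e-3` — see the
physics ledger in the header; none of these is certifiable as an ABSOLUTE number without a lower
bound on `e_per`). [folklore] -/
theorem g_le_of_dimer {g C : ℝ} (h : StarCoercivityWith g C) : g ≤ -ePer - 1 / 24 := by
  have key := h.zero_slack (1 + 1) (pile 1) pile_one_injective
  rw [defects_pile, interactionEnergy_pile] at key
  push_cast at key
  norm_num at key
  linarith


/-! ## §10 One real number: the extremal constant `g⋆`

`Q = {(E_LJ(x) − N·e_per)/#Def(x) : x injective, #Def(x) > 0}` (the DEFECT QUOTIENTS) and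
`g⋆ = sInf Q`.  Then (i) every admissible `(g, C)` has `g ≤ g⋆` (via §8, no hypothesis);
(ii) granted the genuine infimum (`BddBelow`, item 0714 — itself OUTPUT of the crux, §3),
`StarCoercivityWith g⋆ 0` holds, so the admissible set of `g` (at any `C`) is EXACTLY `(-∞, g⋆]`
(the supremum is attained); (iii) `StarCoercivity ↔ BddBelow ∧ 0 < g⋆`.  The crux is the sign
of one real number; the physics ledger reads `g⋆ ≈ 5·10⁻³` (all explicit families positive). -/

/-- The defect quotient `(E_LJ(x) − N·e_per)/#Def(x)` of a configuration. -/
def defectQuotient {N : ℕ} (x : Fin N → E3) : ℝ :=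
  (interactionEnergy lennardJones x - (N : ℝ) * ePer) / (defects x : ℝ)

/-- The set `Q` of defect quotients of injective configurations with at least one defective
site. -/
def quotientSet : Set ℝ :=
  {q | ∃ (N : ℕ) (x : Fin N → E3), Function.Injective x ∧ 0 < defects x ∧ q = defectQuotient x}

/-- **The extremal constant** `g⋆ = inf Q` (a conditionally complete infimum on `ℝ`). -/
def gStar : ℝ := sInf quotientSet

/-- `−e_per ∈ Q` (one isolated particle: defective, energy `0`); in particular `Q ≠ ∅`. -/
theorem neg_ePer_mem_quotientSet : -ePer ∈ quotientSet := by
  refine ⟨1, lineConfig 1, lineConfig_injective 1, by rw [defects_lineConfig]; exact one_pos, ?_⟩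
  unfold defectQuotient
  rw [defects_lineConfig, interactionEnergy_of_subsingleton lennardJones _]
  simp

theorem quotientSet_nonempty : quotientSet.Nonempty := ⟨_, neg_ePer_mem_quotientSet⟩

/-- **(i) Every admissible `g` is `≤ g⋆`** (through the `C = 0` form of §8; no hypothesis on
`e_per`). -/
theorem le_gStar_of_starCoercivityWith {g C : ℝ} (h : StarCoercivityWith g C) : g ≤ gStar := by
  refine le_csInf quotientSet_nonempty ?_
  rintro q ⟨N, x, hx, hd, rfl⟩
  have key := h.zero_slack N x hx
  simp only [zero_mul, sub_zero] at key
  unfold defectQuotient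
  have hd' : (0 : ℝ) < (defects x : ℝ) := by exact_mod_cast hd
  rw [le_div_iff₀ hd']
  linarith

/-- Granted the genuine infimum, every defect quotient is `≥ 0`, so `Q` is bounded below … -/
theorem quotientSet_bddBelow
    (hB : BddBelow (Set.range fun Q : PeriodicConfiguration 3 => Q.energyPerParticle lennardJones)) :
    BddBelow quotientSet := by
  refine ⟨0, ?_⟩
  rintro q ⟨N, x, hx, hd, rfl⟩
  unfold defectQuotient
  exact div_nonneg (by linarith [card_mul_ePer_le_interactionEnergy hB hx]) (Nat.cast_nonneg _)

/-- … hence `0 ≤ g⋆` … -/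
theorem gStar_nonneg
    (hB : BddBelow (Set.range fun Q : PeriodicConfiguration 3 => Q.energyPerParticle lennardJones)) :
    0 ≤ gStar := by
  refine le_csInf quotientSet_nonempty ?_
  rintro q ⟨N, x, hx, hd, rfl⟩
  unfold defectQuotient
  exact div_nonneg (by linarith [card_mul_ePer_le_interactionEnergy hB hx]) (Nat.cast_nonneg _)

/-- … and **(ii) the supremum is attained: `StarCoercivityWith g⋆ 0`**. -/
theorem starCoercivityWith_gStar
    (hB : BddBelow (Set.range fun Q : PeriodicConfiguration 3 => Q.energyPerParticle lennardJones)) :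
    StarCoercivityWith gStar 0 := by
  intro N x hx
  simp only [zero_mul, sub_zero]
  have h0 := card_mul_ePer_le_interactionEnergy hB hx
  rcases Nat.eq_zero_or_pos (defects x) with hd | hd
  · rw [hd]; simpa using h0
  · have hq : gStar ≤ defectQuotient x :=
      csInf_le (quotientSet_bddBelow hB) ⟨N, x, hx, hd, rfl⟩
    unfold defectQuotient at hq
    have hd' : (0 : ℝ) < (defects x : ℝ) := by exact_mod_cast hd
    rw [le_div_iff₀ hd'] at hq
    linarith

/-- Hence, granted the genuine infimum, **the admissible constants are exactly `g ≤ g⋆`**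
(at `C = 0`, and by §8 at every `C`). -/
theorem starCoercivityWith_iff_le_gStar
    (hB : BddBelow (Set.range fun Q : PeriodicConfiguration 3 => Q.energyPerParticle lennardJones))
    (g C : ℝ) (hC : 0 ≤ C) : StarCoercivityWith g C ↔ g ≤ gStar := by
  refine ⟨le_gStar_of_starCoercivityWith, fun hg N x hx => ?_⟩
  have h1 := starCoercivityWith_gStar hB N x hx
  have hd : (0 : ℝ) ≤ (defects x : ℝ) := Nat.cast_nonneg _
  have hN : (0 : ℝ) ≤ (N : ℝ) ^ (2 / 3 : ℝ) := Real.rpow_nonneg (Nat.cast_nonneg N) _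
  nlinarith [mul_le_mul_of_nonneg_right hg hd, mul_nonneg hC hN]

/-- **(iii) The crux is the sign of one real number: `StarCoercivity ↔ BddBelow ∧ 0 < g⋆`.** -/
theorem starCoercivity_iff_gStar_pos :
    StarCoercivity ↔
      BddBelow (Set.range fun Q : PeriodicConfiguration 3 => Q.energyPerParticle lennardJones) ∧
        0 < gStar := by
  constructor
  · intro h
    obtain ⟨g, hg, C, hgC⟩ := starCoercivity_iff.1 h
    exact ⟨bddBelow_of_starCoercivity h, hg.trans_le (le_gStar_of_starCoercivityWith hgC)⟩
  · rintro ⟨hB, hpos⟩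
    exact starCoercivity_iff.2 ⟨gStar, hpos, 0, starCoercivityWith_gStar hB⟩

/-- Certified ceilings on `g⋆` RELATIVE to `e_per` (granted the genuine infimum): the vacuum
gives `g⋆ ≤ −e_per`, the unit dimer `g⋆ ≤ −e_per − 1/24`.  (Absolute ceilings need `e_per` from
below — the crux's own difficulty; numerically `g⋆ ≲ 5·10⁻³`, physics ledger.) -/
theorem gStar_le_neg_ePer
    (hB : BddBelow (Set.range fun Q : PeriodicConfiguration 3 => Q.energyPerParticle lennardJones)) :
    gStar ≤ -ePer :=
  csInf_le (quotientSet_bddBelow hB) neg_ePer_mem_quotientSet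

theorem gStar_le_of_dimer
    (hB : BddBelow (Set.range fun Q : PeriodicConfiguration 3 => Q.energyPerParticle lennardJones)) :
    gStar ≤ -ePer - 1 / 24 := by
  have hmem : defectQuotient (pile 1) ∈ quotientSet :=
    ⟨1 + 1, pile 1, pile_one_injective, by rw [defects_pile]; norm_num, rfl⟩
  have h := csInf_le (quotientSet_bddBelow hB) hmem
  have hq : defectQuotient (pile 1) = -ePer - 1 / 24 := by
    unfold defectQuotient
    rw [defects_pile, interactionEnergy_pile]
    push_cast
    ring
  rwa [hq] at h

/-- **Kill criterion in `g⋆` form.** `¬ StarCoercivity ↔ ¬ BddBelow ∨ g⋆ ≤ 0`; and (granted the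
genuine infimum) `g⋆ ≤ 0` says: for every `ε > 0` some injective configuration with a
defective site has excess `E_LJ(x) − N·e_per < ε·#Def(x)`. -/
theorem not_starCoercivity_iff_gStar :
    ¬ StarCoercivity ↔
      ¬ BddBelow (Set.range fun Q : PeriodicConfiguration 3 => Q.energyPerParticle lennardJones) ∨
        gStar ≤ 0 := by
  rw [starCoercivity_iff_gStar_pos, not_and_or, not_lt]

theorem gStar_nonpos_iff
    (hB : BddBelow (Set.range fun Q : PeriodicConfiguration 3 => Q.energyPerParticle lennardJones)) :
    gStar ≤ 0 ↔ ∀ ε : ℝ, 0 < ε → ∃ (N : ℕ) (x : Fin N → E3), Function.Injective x ∧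
      0 < defects x ∧ interactionEnergy lennardJones x - (N : ℝ) * ePer < ε * (defects x : ℝ) := by
  constructor
  · intro h ε hε
    have hlt : sInf quotientSet < ε := h.trans_lt hε
    obtain ⟨q, ⟨N, x, hx, hd, rfl⟩, hqε⟩ := (csInf_lt_iff (quotientSet_bddBelow hB)
      quotientSet_nonempty).1 hlt
    refine ⟨N, x, hx, hd, ?_⟩
    unfold defectQuotient at hqε
    have hd' : (0 : ℝ) < (defects x : ℝ) := by exact_mod_cast hd
    rwa [div_lt_iff₀ hd'] at hqε
  · intro h
    by_contra hpos
    push Not at hpos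
    obtain ⟨N, x, hx, hd, hlt⟩ := h gStar hpos
    have := starCoercivityWith_gStar hB N x hx
    simp only [zero_mul, sub_zero] at this
    linarith



/-! ## §11 The periodic extremal constant `g⋆_per ≤ g⋆`

The torus twin (item 13602) in the same language: `motifDefects P` (verbatim predicate of
13602), `periodicQuotient P = (e(P) − e_per)/(motifDefects P / #motif)`, `g⋆_per = sInf` over
`motifDefects P > 0`.  Then `PeriodicStarCoercivity ↔ BddBelow ∧ 0 < g⋆_per`, the admissible
periodic constants are exactly `g ≤ g⋆_per`, and — by the periodisation of §5/§9 —
**`g⋆_per ≤ g⋆`**: every finite defect quotient dominates a periodic one.  The converse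
`g⋆ ≤ g⋆_per` (blocks of a periodic competitor are finite near-competitors) is the one
structural piece NOT certified here; it is where a periodic competitor's quotient becomes a cap on
the crux's `g` (the physics ledger uses it freely; in Lean only FINITE clusters cap `g⋆` so far:
vacuum `−e_per`, dimer `−e_per − 1/24`). -/

/-- Number of defective motif points of a periodic configuration, shells read in `P.points`
(verbatim from item 13602). -/
def motifDefects (P : PeriodicConfiguration 3) : ℕ :=
  (P.motif.filter fun s => ¬ ∃ a : ℝ, 9 / 10 ≤ a ∧ a ≤ 11 / 10 ∧
    (ShellCloseTo (1 / 20) ((P.finite_inter_points (K := Metric.closedBall s (6 / 5) \ {s})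
      (Metric.isBounded_closedBall.subset Set.sdiff_subset)).toFinset.image fun y => a⁻¹ • (y - s))
      fccKissingPattern ∨
     ShellCloseTo (1 / 20) ((P.finite_inter_points (K := Metric.closedBall s (6 / 5) \ {s})
      (Metric.isBounded_closedBall.subset Set.sdiff_subset)).toFinset.image fun y => a⁻¹ • (y - s))
      hcpKissingPattern)).card

/-- Item 13602 with the constant exposed. -/
def PeriodicStarCoercivityWith (g : ℝ) : Prop :=
  ∀ P : PeriodicConfiguration 3,
    ePer + g * (motifDefects P : ℝ) / (P.motif.card : ℝ) ≤ P.energyPerParticle lennardJones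

open Summit.AtomisticToContinuum.Crystallization.Theses.ReggeStarCoercivity (PeriodicStarCoercivity) in
/-- Item 13602 is literally `∃ g > 0, PeriodicStarCoercivityWith g`. -/
theorem periodicStarCoercivity_iff :
    PeriodicStarCoercivity ↔ ∃ g : ℝ, 0 < g ∧ PeriodicStarCoercivityWith g :=
  Iff.rfl

/-- The periodic defect quotient `(e(P) − e_per)·#motif/motifDefects`. -/
def periodicQuotient (P : PeriodicConfiguration 3) : ℝ :=
  (P.energyPerParticle lennardJones - ePer) * (P.motif.card : ℝ) / (motifDefects P : ℝ)

/-- The set of periodic defect quotients (configurations with a defective motif point). -/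
def periodicQuotientSet : Set ℝ :=
  {q | ∃ P : PeriodicConfiguration 3, 0 < motifDefects P ∧ q = periodicQuotient P}

/-- **The periodic extremal constant** `g⋆_per`. -/
def gPer : ℝ := sInf periodicQuotientSet

theorem motif_card_pos (P : PeriodicConfiguration 3) : (0 : ℝ) < (P.motif.card : ℝ) := by
  exact_mod_cast Finset.card_pos.2 P.motif_nonempty

/-- The periodisation of `x` has `#Def(x)` defective motif points … -/
theorem motifDefects_periodise {N : ℕ} {x : Fin N → E3} (hN : 0 < N) (hx : Function.Injective x) :
    motifDefects (periodise x hN) = defects x := by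
  unfold motifDefects
  rw [card_filter_motif_periodise hN hx _ (fun i => ?_)]
  simp only [toFinset_inter_points_image hN hx i, IsDefective]

/-- … among `N` motif points. -/
theorem motif_card_periodise {N : ℕ} {x : Fin N → E3} (hN : 0 < N) (hx : Function.Injective x) :
    ((periodise x hN).motif.card : ℝ) = N := by
  rw [motif_periodise, Finset.card_image_of_injective _ hx]
  simp

/-- **Every finite defect quotient dominates a periodic one** (the periodisation of §5). -/
theorem periodicQuotient_periodise_le {N : ℕ} {x : Fin N → E3} (hN : 0 < N)
    (hx : Function.Injective x) (hd : 0 < defects x) :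
    periodicQuotient (periodise x hN) ≤ defectQuotient x := by
  unfold periodicQuotient defectQuotient
  rw [motifDefects_periodise hN hx, motif_card_periodise hN hx]
  have hNr : (0 : ℝ) < N := by exact_mod_cast hN
  have hd' : (0 : ℝ) < (defects x : ℝ) := by exact_mod_cast hd
  have h2 := energyPerParticle_periodise_le hx hN
  rw [div_le_div_iff_of_pos_right hd']
  have : ((periodise x hN).energyPerParticle lennardJones - ePer) * (N : ℝ) ≤
      (interactionEnergy lennardJones x / N - ePer) * N :=
    mul_le_mul_of_nonneg_right (by linarith) hNr.le
  calc ((periodise x hN).energyPerParticle lennardJones - ePer) * (N : ℝ)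
      ≤ (interactionEnergy lennardJones x / N - ePer) * N := this
    _ = interactionEnergy lennardJones x - (N : ℝ) * ePer := by field_simp

/-- `periodicQuotientSet` is non-empty (periodise one isolated particle) … -/
theorem periodicQuotientSet_nonempty : periodicQuotientSet.Nonempty :=
  ⟨_, periodise (lineConfig 1) one_pos, by
    rw [motifDefects_periodise one_pos (lineConfig_injective 1), defects_lineConfig]; exact one_pos,
    rfl⟩

/-- … and, granted the genuine infimum, bounded below by `0`. -/
theorem periodicQuotientSet_bddBelow
    (hB : BddBelow (Set.range fun Q : PeriodicConfiguration 3 => Q.energyPerParticle lennardJones)) :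
    BddBelow periodicQuotientSet := by
  refine ⟨0, ?_⟩
  rintro q ⟨P, hP, rfl⟩
  unfold periodicQuotient
  have h1 : ePer ≤ P.energyPerParticle lennardJones := ciInf_le hB P
  exact div_nonneg (mul_nonneg (by linarith) (Nat.cast_nonneg _)) (Nat.cast_nonneg _)

/-- Every admissible periodic constant is `≤ g⋆_per` (no hypothesis). -/
theorem le_gPer_of_periodicStarCoercivityWith {g : ℝ} (h : PeriodicStarCoercivityWith g) :
    g ≤ gPer := by
  refine le_csInf periodicQuotientSet_nonempty ?_
  rintro q ⟨P, hP, rfl⟩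
  have key := h P
  unfold periodicQuotient
  have hP' : (0 : ℝ) < (motifDefects P : ℝ) := by exact_mod_cast hP
  have hm := motif_card_pos P
  rw [le_div_iff₀ hP']
  have key' : g * (motifDefects P : ℝ) / P.motif.card ≤ P.energyPerParticle lennardJones - ePer := by
    linarith
  rw [div_le_iff₀ hm] at key'
  linarith

/-- Granted the genuine infimum, `PeriodicStarCoercivityWith g⋆_per` holds (the supremum is
attained) … -/
theorem periodicStarCoercivityWith_gPer
    (hB : BddBelow (Set.range fun Q : PeriodicConfiguration 3 => Q.energyPerParticle lennardJones)) :
    PeriodicStarCoercivityWith gPer := by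
  intro P
  have h1 : ePer ≤ P.energyPerParticle lennardJones := ciInf_le hB P
  have hm := motif_card_pos P
  rcases Nat.eq_zero_or_pos (motifDefects P) with hP | hP
  · rw [hP]; simpa using h1
  · have hq : gPer ≤ periodicQuotient P := csInf_le (periodicQuotientSet_bddBelow hB) ⟨P, hP, rfl⟩
    unfold periodicQuotient at hq
    have hP' : (0 : ℝ) < (motifDefects P : ℝ) := by exact_mod_cast hP
    rw [le_div_iff₀ hP'] at hq
    have : gPer * (motifDefects P : ℝ) / P.motif.card ≤ P.energyPerParticle lennardJones - ePer := by
      rw [div_le_iff₀ hm]; linarith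
    linarith

/-- … so the admissible periodic constants are exactly `g ≤ g⋆_per` … -/
theorem periodicStarCoercivityWith_iff_le_gPer
    (hB : BddBelow (Set.range fun Q : PeriodicConfiguration 3 => Q.energyPerParticle lennardJones))
    (g : ℝ) : PeriodicStarCoercivityWith g ↔ g ≤ gPer := by
  refine ⟨le_gPer_of_periodicStarCoercivityWith, fun hg P => ?_⟩
  have h1 := periodicStarCoercivityWith_gPer hB P
  have hm := motif_card_pos P
  have hd : (0 : ℝ) ≤ (motifDefects P : ℝ) / P.motif.card := by positivity
  have : g * (motifDefects P : ℝ) / P.motif.card ≤ gPer * (motifDefects P : ℝ) / P.motif.card := by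
    rw [mul_div_assoc, mul_div_assoc]
    exact mul_le_mul_of_nonneg_right hg hd
  linarith

open Summit.AtomisticToContinuum.Crystallization.Theses.ReggeStarCoercivity (PeriodicStarCoercivity) in
/-- … and **item 13602 is the sign of `g⋆_per`: `PeriodicStarCoercivity ↔ BddBelow ∧ 0 < g⋆_per`**
(`BddBelow` through §9 and §3). -/
theorem periodicStarCoercivity_iff_gPer_pos :
    PeriodicStarCoercivity ↔
      BddBelow (Set.range fun Q : PeriodicConfiguration 3 => Q.energyPerParticle lennardJones) ∧
        0 < gPer := by
  constructor
  · intro h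
    obtain ⟨g, hg, hgP⟩ := periodicStarCoercivity_iff.1 h
    exact ⟨bddBelow_of_starCoercivity (starCoercivity_of_periodicStarCoercivity h),
      hg.trans_le (le_gPer_of_periodicStarCoercivityWith hgP)⟩
  · rintro ⟨hB, hpos⟩
    exact periodicStarCoercivity_iff.2 ⟨gPer, hpos, periodicStarCoercivityWith_gPer hB⟩

/-- **`g⋆_per ≤ g⋆`** (granted the genuine infimum): periodising a finite witness. -/
theorem gPer_le_gStar
    (hB : BddBelow (Set.range fun Q : PeriodicConfiguration 3 => Q.energyPerParticle lennardJones)) :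
    gPer ≤ gStar := by
  refine le_csInf quotientSet_nonempty ?_
  rintro q ⟨N, x, hx, hd, rfl⟩
  have hN : 0 < N := lt_of_lt_of_le hd (defects_le x)
  calc gPer ≤ periodicQuotient (periodise x hN) :=
        csInf_le (periodicQuotientSet_bddBelow hB)
          ⟨periodise x hN, by rwa [motifDefects_periodise hN hx], rfl⟩
    _ ≤ defectQuotient x := periodicQuotient_periodise_le hN hx hd

/-- §9 recovered at the level of constants: `PeriodicStarCoercivityWith g → StarCoercivityWith g 0`
(for `g ≤ g⋆_per ≤ g⋆`; granted the genuine infimum — which the hypothesis with `g > 0` itself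
yields, cf. `periodicStarCoercivity_iff_gPer_pos`). -/
theorem starCoercivityWith_of_periodicStarCoercivityWith
    (hB : BddBelow (Set.range fun Q : PeriodicConfiguration 3 => Q.energyPerParticle lennardJones))
    {g : ℝ} (h : PeriodicStarCoercivityWith g) : StarCoercivityWith g 0 :=
  (starCoercivityWith_iff_le_gStar hB g 0 le_rfl).2
    ((le_gPer_of_periodicStarCoercivityWith h).trans (gPer_le_gStar hB))



/-! ## §12 Blocks of a periodic configuration: `g⋆ ≤ g⋆_per`, hence `13600 ⇔ 13602` -/

section Blocks

variable (P : PeriodicConfiguration 3)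

instance latticeModuleFinite : Module.Finite ℤ P.lattice := ZLattice.module_finite ℝ P.lattice

/-- A `ℤ`-basis of the lattice of periods, indexed by `Fin 3`. -/
def latticeBasis : Module.Basis (Fin 3) ℤ P.lattice :=
  Module.finBasisOfFinrankEq ℤ P.lattice P.finrank_lattice

/-- The same three vectors as an `ℝ`-basis of `ℝ³`. -/
def realBasis : Module.Basis (Fin 3) ℝ E3 := (latticeBasis P).ofZLatticeBasis ℝ P.lattice

theorem realBasis_apply (i : Fin 3) : realBasis P i = (latticeBasis P i : E3) :=
  Module.Basis.ofZLatticeBasis_apply ℝ P.lattice (latticeBasis P) i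

/-- The lattice vector with integer coordinates `k`. -/
def latVec (k : Fin 3 → ℤ) : E3 := ∑ i, (k i : ℝ) • (latticeBasis P i : E3)

theorem latVec_mem (k : Fin 3 → ℤ) : latVec P k ∈ P.lattice := by
  refine Submodule.sum_mem _ fun i _ => ?_
  rw [Int.cast_smul_eq_zsmul ℝ]
  exact P.lattice.smul_mem (k i) (latticeBasis P i).2

theorem latVec_sub (k l : Fin 3 → ℤ) : latVec P (k - l) = latVec P k - latVec P l := by
  simp only [latVec, Pi.sub_apply, Int.cast_sub, sub_smul, Finset.sum_sub_distrib]

theorem latVec_eq_sum_realBasis (k : Fin 3 → ℤ) : latVec P k = ∑ i, (k i : ℝ) • realBasis P i := by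
  simp only [latVec, realBasis_apply]

theorem repr_latVec (k : Fin 3 → ℤ) (i : Fin 3) : (realBasis P).repr (latVec P k) i = k i := by
  rw [latVec_eq_sum_realBasis, (realBasis P).repr_sum_self]

theorem latVec_injective : Function.Injective (latVec P) := by
  intro k l h
  funext i
  have h1 := repr_latVec P k i
  rw [h, repr_latVec] at h1
  exact_mod_cast h1.symm

theorem exists_latVec_of_mem {g : E3} (hg : g ∈ P.lattice) : ∃ k : Fin 3 → ℤ, g = latVec P k := by
  refine ⟨fun i => (latticeBasis P).repr ⟨g, hg⟩ i, ?_⟩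
  have h2 : ∀ i, (realBasis P).repr g i = (((latticeBasis P).repr ⟨g, hg⟩ i : ℤ) : ℝ) := fun i => by
    have := Module.Basis.ofZLatticeBasis_repr_apply ℝ P.lattice (latticeBasis P) ⟨g, hg⟩ i
    simpa [realBasis] using this
  rw [latVec_eq_sum_realBasis]
  conv_lhs => rw [← (realBasis P).sum_repr g]
  simp only [h2]

/-- Index set of the block of side `n`: a cell multi-index and a motif point. -/
abbrev BlockIdx (n : ℕ) := (Fin 3 → Fin n) × {z : E3 // z ∈ P.motif}

/-- Integer coordinates of a cell multi-index. -/
def cellInt {n : ℕ} (k : Fin 3 → Fin n) : Fin 3 → ℤ := fun i => ((k i : ℕ) : ℤ)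

/-- The period attached to a cell multi-index. -/
def cellVec {n : ℕ} (k : Fin 3 → Fin n) : E3 := latVec P (cellInt k)

theorem cellVec_mem {n : ℕ} (k : Fin 3 → Fin n) : cellVec P k ∈ P.lattice := latVec_mem P _

/-- **The block**: `z + Σ kᵢ bᵢ`, `z ∈ motif`, `0 ≤ kᵢ < n`. -/
def blockPt (n : ℕ) (a : BlockIdx P n) : E3 := (a.2 : E3) + cellVec P a.1

theorem blockPt_mem_points {n : ℕ} (a : BlockIdx P n) : blockPt P n a ∈ P.points :=
  ⟨a.2, a.2.2, _, cellVec_mem P a.1, rfl⟩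

theorem cellInt_injective {n : ℕ} : Function.Injective (cellInt (n := n)) := by
  intro k l h
  funext i
  have := congrFun h i
  simp only [cellInt, Nat.cast_inj] at this
  exact Fin.ext this

theorem blockPt_injective (n : ℕ) : Function.Injective (blockPt P n) := by
  rintro ⟨k, z⟩ ⟨k', z'⟩ h
  simp only [blockPt] at h
  have hzz : (z : E3) = z' := by
    apply P.eq_of_sub_mem _ z.2 _ z'.2
    have : (z : E3) - z' = cellVec P k' - cellVec P k := by
      rw [sub_eq_sub_iff_add_eq_add, h, add_comm]
    rw [this]
    exact P.lattice.sub_mem (cellVec_mem P k') (cellVec_mem P k)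
  rw [hzz] at h
  have hk : cellVec P k = cellVec P k' := add_left_cancel h
  exact Prod.ext (cellInt_injective (latVec_injective P hk)) (Subtype.ext hzz)

/-- Translating a block point back by its cell vector gives its motif point. -/
theorem blockPt_sub_cellVec {n : ℕ} (a : BlockIdx P n) : blockPt P n a - cellVec P a.1 = a.2 := by
  simp [blockPt]

/-! ### Site sums and their invariance under periods -/

/-- The punctured point set seen from `w`. -/
abbrev Punct (w : E3) := {u : E3 // u ∈ P.points ∧ u ≠ w}

/-- The lattice sum at `w`: `∑'_{u ∈ points, u ≠ w} V_LJ(|w − u|)`. -/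
def siteSum (w : E3) : ℝ := ∑' u : Punct P w, lennardJones (dist w u.1)

theorem energyPerParticle_eq_siteSum :
    P.energyPerParticle lennardJones = (2 * (P.motif.card : ℝ))⁻¹ * ∑ z ∈ P.motif, siteSum P z :=
  rfl

theorem sum_siteSum_eq :
    ∑ z ∈ P.motif, siteSum P z = 2 * (P.motif.card : ℝ) * P.energyPerParticle lennardJones := by
  rw [energyPerParticle_eq_siteSum]
  have hm : (0 : ℝ) < P.motif.card := by exact_mod_cast Finset.card_pos.2 P.motif_nonempty
  field_simp

/-- Translating by a period is a bijection of punctured point sets. -/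
def shiftEquiv (w : E3) {g : E3} (hg : g ∈ P.lattice) : Punct P w ≃ Punct P (w + g) where
  toFun u := ⟨u.1 + g, P.add_mem_points u.2.1 hg, fun h => u.2.2 (add_right_cancel h)⟩
  invFun u := ⟨u.1 - g, by
      have := P.add_mem_points u.2.1 (P.lattice.neg_mem hg)
      simpa [sub_eq_add_neg] using this,
    fun h => u.2.2 (eq_add_of_sub_eq h)⟩
  left_inv u := Subtype.ext (by simp)
  right_inv u := Subtype.ext (by simp)

@[simp] theorem shiftEquiv_apply_val (w : E3) {g : E3} (hg : g ∈ P.lattice) (u : Punct P w) :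
    ((shiftEquiv P w hg u : Punct P (w + g)) : E3) = u.1 + g := rfl

theorem siteSum_add_of_mem (w : E3) {g : E3} (hg : g ∈ P.lattice) :
    siteSum P (w + g) = siteSum P w := by
  unfold siteSum
  rw [← (shiftEquiv P w hg).tsum_eq]
  congr 1 with u
  rw [shiftEquiv_apply_val, dist_add_right]

/-- The inverse sixth powers beyond radius `R`, seen from `w`. -/
def tailSum (w : E3) (R : ℝ) : ℝ :=
  ∑' u : Punct P w, {u : Punct P w | R < dist w u.1}.indicator (fun u => (dist w u.1)⁻¹ ^ 6) u

/-- All inverse sixth powers seen from `w`. -/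
def invSixSum (w : E3) : ℝ := ∑' u : Punct P w, (dist w u.1)⁻¹ ^ 6

theorem summable_invSix (w : E3) : Summable fun u : Punct P w => (dist w u.1)⁻¹ ^ 6 :=
  P.summable_inv_pow_six_dist (by norm_num) w

theorem invSix_nonneg (w : E3) (u : Punct P w) : 0 ≤ (dist w u.1)⁻¹ ^ 6 := by positivity

theorem tailSum_nonneg (w : E3) (R : ℝ) : 0 ≤ tailSum P w R :=
  tsum_nonneg fun u => Set.indicator_nonneg (fun v _ => invSix_nonneg P w v) u

theorem invSixSum_nonneg (w : E3) : 0 ≤ invSixSum P w := tsum_nonneg fun u => invSix_nonneg P w u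

theorem tailSum_le_invSixSum (w : E3) (R : ℝ) : tailSum P w R ≤ invSixSum P w := by
  unfold tailSum invSixSum
  refine Summable.tsum_le_tsum (fun u => ?_) ((summable_invSix P w).indicator _) (summable_invSix P w)
  exact Set.indicator_le_self' (fun _ _ => invSix_nonneg P w u) u

theorem tailSum_antitone (w : E3) {R R' : ℝ} (h : R ≤ R') : tailSum P w R' ≤ tailSum P w R := by
  unfold tailSum
  refine Summable.tsum_le_tsum (fun u => ?_) ((summable_invSix P w).indicator _)
    ((summable_invSix P w).indicator _)
  refine Set.indicator_le_indicator_of_subset (fun v hv => ?_) (fun v => invSix_nonneg P w v) u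
  simp only [Set.mem_setOf_eq] at hv ⊢
  exact lt_of_le_of_lt h hv

theorem invSixSum_add_of_mem (w : E3) {g : E3} (hg : g ∈ P.lattice) :
    invSixSum P (w + g) = invSixSum P w := by
  unfold invSixSum
  rw [← (shiftEquiv P w hg).tsum_eq]
  congr 1 with u
  rw [shiftEquiv_apply_val, dist_add_right]

theorem tailSum_add_of_mem (w : E3) {g : E3} (hg : g ∈ P.lattice) (R : ℝ) :
    tailSum P (w + g) R = tailSum P w R := by
  unfold tailSum
  rw [← (shiftEquiv P w hg).tsum_eq]
  congr 1 with u
  simp only [Set.indicator, Set.mem_setOf_eq, shiftEquiv_apply_val, dist_add_right]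

/-- **Tails are small**: for every `ε > 0` some radius `R` has `tailSum P w R < ε`. -/
theorem exists_tailSum_lt (w : E3) {ε : ℝ} (hε : 0 < ε) : ∃ R : ℝ, tailSum P w R < ε := by
  set f : Punct P w → ℝ := fun u => (dist w u.1)⁻¹ ^ 6 with hf
  have h := tendsto_tsum_compl_atTop_zero f
  obtain ⟨s, hs⟩ := (h.eventually (gt_mem_nhds hε)).exists
  refine ⟨∑ u ∈ s, dist w u.1, ?_⟩
  have hsub : {u : Punct P w | (∑ v ∈ s, dist w v.1) < dist w u.1} ⊆ {u | u ∉ s} := by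
    intro u hu hus
    have : dist w u.1 ≤ ∑ v ∈ s, dist w v.1 :=
      Finset.single_le_sum (f := fun v : Punct P w => dist w v.1) (fun v _ => dist_nonneg) hus
    exact absurd hu (not_lt.2 this)
  have h1 : ∑' u : {u // u ∉ s}, f u = ∑' u, ({u | u ∉ s} : Set (Punct P w)).indicator f u :=
    tsum_subtype _ f
  have h2 : tailSum P w (∑ u ∈ s, dist w u.1) ≤
      ∑' u, ({u | u ∉ s} : Set (Punct P w)).indicator f u := by
    unfold tailSum
    refine Summable.tsum_le_tsum (fun u => ?_) ((summable_invSix P w).indicator _)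
      ((summable_invSix P w).indicator _)
    exact Set.indicator_le_indicator_of_subset hsub (fun u => invSix_nonneg P w u) u
  calc tailSum P w (∑ u ∈ s, dist w u.1)
      ≤ ∑' u, ({u | u ∉ s} : Set (Punct P w)).indicator f u := h2
    _ = ∑' u : {u // u ∉ s}, f u := h1.symm
    _ < ε := hs

/-! ### Coordinates: a uniform bound, and the interior margin -/

theorem exists_coord_bound :
    ∃ C : ℝ, 0 ≤ C ∧ ∀ (v : E3) (i : Fin 3), |(realBasis P).repr v i| ≤ C * ‖v‖ := by
  set φ : Fin 3 → (E3 →L[ℝ] ℝ) := fun i => LinearMap.toContinuousLinearMap ((realBasis P).coord i)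
    with hφ
  refine ⟨∑ i, ‖φ i‖, Finset.sum_nonneg fun i _ => norm_nonneg _, fun v i => ?_⟩
  have h1 : (realBasis P).repr v i = φ i v := by simp [hφ, Module.Basis.coord]
  rw [h1]
  calc |φ i v| = ‖φ i v‖ := (Real.norm_eq_abs _).symm
    _ ≤ ‖φ i‖ * ‖v‖ := (φ i).le_opNorm v
    _ ≤ (∑ j, ‖φ j‖) * ‖v‖ :=
        mul_le_mul_of_nonneg_right
          (Finset.single_le_sum (f := fun j => ‖φ j‖) (fun j _ => norm_nonneg (φ j))
            (Finset.mem_univ i)) (norm_nonneg v)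

/-- The coordinate constant `C`: `|coordᵢ(v)| ≤ C‖v‖`. -/
def coordC : ℝ := Classical.choose (exists_coord_bound P)

theorem coordC_nonneg : 0 ≤ coordC P := (Classical.choose_spec (exists_coord_bound P)).1

theorem abs_repr_le (v : E3) (i : Fin 3) : |(realBasis P).repr v i| ≤ coordC P * ‖v‖ :=
  (Classical.choose_spec (exists_coord_bound P)).2 v i

/-- A bound on the diameter of the motif. -/
def motifDiam : ℝ := 2 * ∑ z ∈ P.motif, ‖z‖

theorem norm_sub_le_motifDiam {z z' : E3} (hz : z ∈ P.motif) (hz' : z' ∈ P.motif) :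
    ‖z - z'‖ ≤ motifDiam P := by
  have h1 : ‖z‖ ≤ ∑ y ∈ P.motif, ‖y‖ :=
    Finset.single_le_sum (f := fun y : E3 => ‖y‖) (fun _ _ => norm_nonneg _) hz
  have h2 : ‖z'‖ ≤ ∑ y ∈ P.motif, ‖y‖ :=
    Finset.single_le_sum (f := fun y : E3 => ‖y‖) (fun _ _ => norm_nonneg _) hz'
  unfold motifDiam
  linarith [norm_sub_le z z']

theorem motifDiam_nonneg : 0 ≤ motifDiam P := by
  unfold motifDiam
  have := Finset.sum_nonneg fun (z : E3) (_ : z ∈ P.motif) => norm_nonneg z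
  linarith

/-- The interior margin (in cells) that keeps every point within distance `R` of an interior
block point inside the block. -/
def margin (R : ℝ) : ℕ := ⌈coordC P * (R + motifDiam P)⌉₊ + 1

theorem lt_margin (R : ℝ) : coordC P * (R + motifDiam P) < margin P R := by
  unfold margin
  push_cast
  linarith [Nat.le_ceil (coordC P * (R + motifDiam P))]

/-- Interior cell multi-indices: every coordinate at least `r` away from both faces. -/
def IsInterior (r n : ℕ) (k : Fin 3 → Fin n) : Prop := ∀ i, r ≤ (k i : ℕ) ∧ (k i : ℕ) + r < n

/-- **Interior block points see only block points within distance `R`.** -/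
theorem exists_blockIdx_of_dist_le {R : ℝ} {n : ℕ} {a : BlockIdx P n}
    (ha : IsInterior (margin P R) n a.1) {u : E3} (hu : u ∈ P.points)
    (hdist : dist (blockPt P n a) u ≤ R) : ∃ b : BlockIdx P n, blockPt P n b = u := by
  obtain ⟨z', hz', g', hg', rfl⟩ := hu
  obtain ⟨c, rfl⟩ := exists_latVec_of_mem P hg'
  set kz : Fin 3 → ℤ := cellInt a.1 with hkz
  have hv : z' + latVec P c - blockPt P n a = (z' - a.2) + latVec P (c - kz) := by
    simp only [blockPt, cellVec, latVec_sub, hkz]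
    abel
  have hcoord : ∀ i, |((c i - kz i : ℤ) : ℝ)| < margin P R := by
    intro i
    have h1 : (realBasis P).repr (z' + latVec P c - blockPt P n a) i =
        (realBasis P).repr (z' - a.2) i + ((c i - kz i : ℤ) : ℝ) := by
      rw [hv, map_add, Finsupp.add_apply, repr_latVec]
      simp
    have h2 := abs_repr_le P (z' + latVec P c - blockPt P n a) i
    have h3 := abs_repr_le P ((z' : E3) - a.2) i
    have hvn : ‖z' + latVec P c - blockPt P n a‖ ≤ R := by
      rw [← dist_eq_norm, dist_comm]; exact hdist
    have hD := norm_sub_le_motifDiam P hz' a.2.2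
    have hC := coordC_nonneg P
    have e : ((c i - kz i : ℤ) : ℝ) = (realBasis P).repr (z' + latVec P c - blockPt P n a) i -
        (realBasis P).repr (z' - a.2) i := by linarith [h1]
    have : |((c i - kz i : ℤ) : ℝ)| ≤ coordC P * R + coordC P * motifDiam P := by
      rw [e]
      calc _ ≤ |(realBasis P).repr (z' + latVec P c - blockPt P n a) i| +
            |(realBasis P).repr ((z' : E3) - a.2) i| := abs_sub _ _
        _ ≤ coordC P * ‖z' + latVec P c - blockPt P n a‖ + coordC P * ‖(z' : E3) - a.2‖ :=
            add_le_add h2 h3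
        _ ≤ coordC P * R + coordC P * motifDiam P := by gcongr
    calc _ ≤ _ := this
      _ = coordC P * (R + motifDiam P) := by ring
      _ < margin P R := lt_margin P R
  have hc : ∀ i, 0 ≤ c i ∧ c i < n := by
    intro i
    obtain ⟨hri, hin⟩ := ha i
    have h' : |c i - kz i| < (margin P R : ℤ) := by
      have := hcoord i
      rw [← Int.cast_abs] at this
      exact_mod_cast this
    rw [abs_lt] at h'
    simp only [hkz, cellInt] at h'
    constructor <;> omega
  refine ⟨(fun i => ⟨(c i).toNat, by have := hc i; omega⟩, ⟨z', hz'⟩), ?_⟩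
  simp only [blockPt, cellVec]
  congr 2
  funext i
  simp [cellInt, Int.toNat_of_nonneg (hc i).1]


/-- The defect predicate of item 13602 for a point `s` (shell read in `P.points`). -/
def MotifDefective (s : E3) : Prop :=
  ¬ ∃ a : ℝ, 9 / 10 ≤ a ∧ a ≤ 11 / 10 ∧
    (ShellCloseTo (1 / 20) ((P.finite_inter_points (K := Metric.closedBall s (6 / 5) \ {s})
      (Metric.isBounded_closedBall.subset Set.sdiff_subset)).toFinset.image fun y => a⁻¹ • (y - s))
      fccKissingPattern ∨
     ShellCloseTo (1 / 20) ((P.finite_inter_points (K := Metric.closedBall s (6 / 5) \ {s})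
      (Metric.isBounded_closedBall.subset Set.sdiff_subset)).toFinset.image fun y => a⁻¹ • (y - s))
      hcpKissingPattern)

theorem motifDefects_eq_card_filter : motifDefects P = (P.motif.filter (MotifDefective P)).card := by
  unfold motifDefects MotifDefective
  congr

/-! ### The energy of a block -/

variable {P}

/-- The other block points, as a finset of the punctured point set at `blockPt a`. -/
def blockNbrs (n : ℕ) (a : BlockIdx P n) : Finset (Punct P (blockPt P n a)) :=
  (Finset.univ.erase a).attach.image fun b =>
    ⟨blockPt P n b.1, blockPt_mem_points P b.1,
      fun h => (Finset.mem_erase.1 b.2).1 (blockPt_injective P n h)⟩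

theorem mem_blockNbrs_of_ne {n : ℕ} {a b : BlockIdx P n} (hba : b ≠ a) :
    (⟨blockPt P n b, blockPt_mem_points P b, fun h => hba (blockPt_injective P n h)⟩ :
      Punct P (blockPt P n a)) ∈ blockNbrs n a := by
  simp only [blockNbrs, Finset.mem_image, Finset.mem_attach, true_and, Subtype.exists,
    Finset.mem_erase, Finset.mem_univ, and_true]
  exact ⟨b, hba, rfl⟩

theorem sum_erase_eq_sum_blockNbrs (n : ℕ) (a : BlockIdx P n) :
    ∑ b ∈ Finset.univ.erase a, lennardJones (dist (blockPt P n a) (blockPt P n b)) =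
      ∑ u ∈ blockNbrs n a, lennardJones (dist (blockPt P n a) u.1) := by
  unfold blockNbrs
  rw [Finset.sum_image]
  · exact (Finset.sum_attach (Finset.univ.erase a)
      (fun b => lennardJones (dist (blockPt P n a) (blockPt P n b)))).symm
  · intro b _ b' _ h
    exact Subtype.ext (blockPt_injective P n (congrArg Subtype.val h))

/-- The inverse sixth powers from `blockPt a` to the points OUTSIDE the block. -/
def outsideSum (n : ℕ) (a : BlockIdx P n) : ℝ :=
  ∑' u : ↥((blockNbrs n a : Set (Punct P (blockPt P n a)))ᶜ), (dist (blockPt P n a) u.1.1)⁻¹ ^ 6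

theorem neg_sixth_le_lennardJones (r : ℝ) : -(1 / 6) * (r⁻¹) ^ 6 ≤ lennardJones r := by
  unfold lennardJones
  have : 0 ≤ (r⁻¹) ^ 12 := by positivity
  nlinarith

/-- **Per-site inequality**: the finite sum over the block is at most the full lattice sum plus
one sixth of the outside inverse-sixth-power sum (`V_LJ ≥ −r⁻⁶/6`). -/
theorem sum_blockNbrs_le (n : ℕ) (a : BlockIdx P n) :
    ∑ u ∈ blockNbrs n a, lennardJones (dist (blockPt P n a) u.1) ≤
      siteSum P (blockPt P n a) + (1 / 6) * outsideSum n a := by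
  have hsum : Summable fun u : Punct P (blockPt P n a) => lennardJones (dist (blockPt P n a) u.1) :=
    P.summable_lennardJones_dist_three (blockPt P n a)
  have hsplit := hsum.sum_add_tsum_compl (s := blockNbrs n a)
  have h6 : Summable fun u : ↥((blockNbrs n a : Set (Punct P (blockPt P n a)))ᶜ) =>
      (dist (blockPt P n a) u.1.1)⁻¹ ^ 6 := (summable_invSix P (blockPt P n a)).subtype _
  have hV : Summable fun u : ↥((blockNbrs n a : Set (Punct P (blockPt P n a)))ᶜ) =>
      lennardJones (dist (blockPt P n a) u.1.1) := hsum.subtype _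
  have hlow : ∑' u : ↥((blockNbrs n a : Set (Punct P (blockPt P n a)))ᶜ),
      (-(1 / 6) * (dist (blockPt P n a) u.1.1)⁻¹ ^ 6) ≤
        ∑' u : ↥((blockNbrs n a : Set (Punct P (blockPt P n a)))ᶜ),
          lennardJones (dist (blockPt P n a) u.1.1) :=
    Summable.tsum_le_tsum (fun u => neg_sixth_le_lennardJones _) (h6.mul_left _) hV
  rw [tsum_mul_left] at hlow
  unfold siteSum outsideSum
  linarith [hsplit]

theorem outsideSum_nonneg (n : ℕ) (a : BlockIdx P n) : 0 ≤ outsideSum n a :=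
  tsum_nonneg fun u => invSix_nonneg P _ u.1

theorem outsideSum_le_invSixSum (n : ℕ) (a : BlockIdx P n) :
    outsideSum n a ≤ invSixSum P (blockPt P n a) :=
  (summable_invSix P (blockPt P n a)).tsum_subtype_le _ _ (fun u => invSix_nonneg P _ u)

/-- For an interior block point the outside sum is a tail sum. -/
theorem outsideSum_le_tailSum {R : ℝ} {n : ℕ} {a : BlockIdx P n}
    (ha : IsInterior (margin P R) n a.1) : outsideSum n a ≤ tailSum P (blockPt P n a) R := by
  have h1 : outsideSum n a = ∑' u : Punct P (blockPt P n a),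
      ((blockNbrs n a : Set (Punct P (blockPt P n a)))ᶜ).indicator
        (fun u => (dist (blockPt P n a) u.1)⁻¹ ^ 6) u := by
    unfold outsideSum
    exact tsum_subtype ((blockNbrs n a : Set (Punct P (blockPt P n a)))ᶜ)
      (fun u : Punct P (blockPt P n a) => (dist (blockPt P n a) u.1)⁻¹ ^ 6)
  rw [h1]
  unfold tailSum
  refine Summable.tsum_le_tsum (fun u => ?_) ((summable_invSix P _).indicator _)
    ((summable_invSix P _).indicator _)
  refine Set.indicator_le_indicator_of_subset (fun v hv => ?_) (fun v => invSix_nonneg P _ v) u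
  simp only [Set.mem_setOf_eq]
  by_contra hle
  push Not at hle
  obtain ⟨b, hb⟩ := exists_blockIdx_of_dist_le P ha v.2.1 hle
  have hba : b ≠ a := fun h => v.2.2 (by rw [← hb, h])
  apply hv
  simp only [Set.mem_compl_iff, Finset.mem_coe] at *
  have := mem_blockNbrs_of_ne hba
  convert this using 1
  exact Subtype.ext hb.symm

/-- The double sum over the block against the lattice sums. -/
theorem sum_sum_blockPt_le (n : ℕ) :
    ∑ a : BlockIdx P n, ∑ b : BlockIdx P n, lennardJones (dist (blockPt P n a) (blockPt P n b)) ≤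
      ∑ a : BlockIdx P n, (siteSum P (blockPt P n a) + (1 / 6) * outsideSum n a) := by
  refine Finset.sum_le_sum fun a _ => ?_
  rw [← Finset.add_sum_erase _ _ (Finset.mem_univ a), dist_self, lennardJones_zero, zero_add,
    sum_erase_eq_sum_blockNbrs]
  exact sum_blockNbrs_le n a

theorem card_cells (n : ℕ) : Fintype.card (Fin 3 → Fin n) = n ^ 3 := by
  simp [Fintype.card_fin]

/-- The lattice sums over the block add up to `n³ · 2·#motif·e(P)`. -/
theorem sum_siteSum_blockPt (n : ℕ) :
    ∑ a : BlockIdx P n, siteSum P (blockPt P n a) =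
      (n : ℝ) ^ 3 * (2 * (P.motif.card : ℝ) * P.energyPerParticle lennardJones) := by
  have h1 : ∀ a : BlockIdx P n, siteSum P (blockPt P n a) = siteSum P a.2 := fun a =>
    siteSum_add_of_mem P _ (cellVec_mem P a.1)
  simp_rw [h1]
  rw [Fintype.sum_prod_type]
  simp only [Finset.sum_const, Finset.card_univ, card_cells, nsmul_eq_mul, Nat.cast_pow]
  rw [Finset.sum_coe_sort P.motif (fun z => siteSum P z), sum_siteSum_eq]

variable (P)

/-- Crude uniform bounds: all inverse sixth powers / all tails beyond `R`, summed over the motif. -/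
def fullB : ℝ := ∑ z ∈ P.motif, invSixSum P z

def tailB (R : ℝ) : ℝ := ∑ z ∈ P.motif, tailSum P z R

theorem invSixSum_le_fullB {z : E3} (hz : z ∈ P.motif) : invSixSum P z ≤ fullB P :=
  Finset.single_le_sum (f := fun z => invSixSum P z) (fun z _ => invSixSum_nonneg P z) hz

theorem tailSum_le_tailB {z : E3} (hz : z ∈ P.motif) (R : ℝ) : tailSum P z R ≤ tailB P R :=
  Finset.single_le_sum (f := fun z => tailSum P z R) (fun z _ => tailSum_nonneg P z R) hz

theorem fullB_nonneg : 0 ≤ fullB P := Finset.sum_nonneg fun z _ => invSixSum_nonneg P z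

theorem tailB_nonneg (R : ℝ) : 0 ≤ tailB P R := Finset.sum_nonneg fun z _ => tailSum_nonneg P z R

/-- **Uniformly small tails over the motif.** -/
theorem exists_tailB_lt {ε : ℝ} (hε : 0 < ε) : ∃ R : ℝ, 2 ≤ R ∧ tailB P R < ε := by
  have hm : (0 : ℝ) < P.motif.card := by exact_mod_cast Finset.card_pos.2 P.motif_nonempty
  have hε' : 0 < ε / (P.motif.card + 1) := by positivity
  choose Rz hRz using fun z : E3 => exists_tailSum_lt P z hε'
  refine ⟨2 + ∑ z ∈ P.motif, |Rz z|, by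
    linarith [Finset.sum_nonneg fun (z : E3) (_ : z ∈ P.motif) => abs_nonneg (Rz z)], ?_⟩
  have hle : ∀ z ∈ P.motif, tailSum P z (2 + ∑ z ∈ P.motif, |Rz z|) ≤ ε / (P.motif.card + 1) := by
    intro z hz
    refine (tailSum_antitone P z ?_).trans (hRz z).le
    have : |Rz z| ≤ ∑ y ∈ P.motif, |Rz y| :=
      Finset.single_le_sum (f := fun y => |Rz y|) (fun _ _ => abs_nonneg _) hz
    linarith [le_abs_self (Rz z)]
  calc tailB P (2 + ∑ z ∈ P.motif, |Rz z|) ≤ ∑ z ∈ P.motif, ε / (P.motif.card + 1) :=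
        Finset.sum_le_sum hle
    _ = P.motif.card * (ε / (P.motif.card + 1)) := by rw [Finset.sum_const, nsmul_eq_mul]
    _ < ε := by
        rw [mul_div_assoc', div_lt_iff₀ (by positivity)]
        nlinarith

variable {P}

theorem outsideSum_le_ite (R : ℝ) (n : ℕ) (a : BlockIdx P n) :
    outsideSum n a ≤ tailB P R + (if IsInterior (margin P R) n a.1 then 0 else fullB P) := by
  split_ifs with h
  · calc outsideSum n a ≤ tailSum P (blockPt P n a) R := outsideSum_le_tailSum h
      _ = tailSum P a.2 R := tailSum_add_of_mem P _ (cellVec_mem P a.1) R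
      _ ≤ tailB P R + 0 := by rw [add_zero]; exact tailSum_le_tailB P a.2.2 R
  · calc outsideSum n a ≤ invSixSum P (blockPt P n a) := outsideSum_le_invSixSum n a
      _ = invSixSum P a.2 := invSixSum_add_of_mem P _ (cellVec_mem P a.1)
      _ ≤ fullB P := invSixSum_le_fullB P a.2.2
      _ ≤ tailB P R + fullB P := by linarith [tailB_nonneg P R]

/-! ### Interior indices: counting -/

/-- Shifting an interior multi-index of side `n'` into the block of side `n' + 2r`. -/
def shiftIdx (r n' : ℕ) (j : Fin 3 → Fin n') : Fin 3 → Fin (n' + 2 * r) :=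
  fun i => ⟨(j i : ℕ) + r, by have := (j i).2; omega⟩

theorem isInterior_shiftIdx (r n' : ℕ) (j : Fin 3 → Fin n') :
    IsInterior r (n' + 2 * r) (shiftIdx r n' j) := fun i => by
  have := (j i).2
  simp only [shiftIdx]
  omega

theorem shiftIdx_injective (r n' : ℕ) : Function.Injective (shiftIdx r n') := by
  intro j j' h
  funext i
  have := congrArg (fun k : Fin 3 → Fin (n' + 2 * r) => ((k i : ℕ))) h
  simp only [shiftIdx] at this
  exact Fin.ext (by omega)

theorem le_card_interior (r n' : ℕ) :
    n' ^ 3 * P.motif.card ≤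
      Fintype.card {a : BlockIdx P (n' + 2 * r) // IsInterior r (n' + 2 * r) a.1} := by
  let f : (Fin 3 → Fin n') × {z : E3 // z ∈ P.motif} →
      {a : BlockIdx P (n' + 2 * r) // IsInterior r (n' + 2 * r) a.1} :=
    fun p => ⟨(shiftIdx r n' p.1, p.2), isInterior_shiftIdx r n' p.1⟩
  have hf : Function.Injective f := by
    rintro ⟨j, z⟩ ⟨j', z'⟩ h
    simp only [f, Subtype.mk.injEq, Prod.mk.injEq] at h
    exact Prod.ext (shiftIdx_injective r n' h.1) h.2
  have := Fintype.card_le_of_injective f hf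
  simpa [Fintype.card_prod, card_cells, Fintype.card_coe] using this

theorem card_not_interior_le (r n' : ℕ) :
    ((Finset.univ.filter fun a : BlockIdx P (n' + 2 * r) => ¬ IsInterior r (n' + 2 * r) a.1).card : ℝ)
      ≤ ((n' + 2 * r : ℕ) : ℝ) ^ 3 * P.motif.card - (n' : ℝ) ^ 3 * P.motif.card := by
  have h1 := Finset.card_filter_add_card_filter_not
    (s := (Finset.univ : Finset (BlockIdx P (n' + 2 * r)))) (fun a => IsInterior r (n' + 2 * r) a.1)
  have h2 := le_card_interior (P := P) r n'
  rw [Fintype.card_subtype] at h2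
  have h3 : (Finset.univ : Finset (BlockIdx P (n' + 2 * r))).card = (n' + 2 * r) ^ 3 * P.motif.card := by
    rw [Finset.card_univ, Fintype.card_prod, card_cells, Fintype.card_coe]
  rw [h3] at h1
  have h4 : ((Finset.univ.filter fun a : BlockIdx P (n' + 2 * r) =>
      ¬ IsInterior r (n' + 2 * r) a.1).card : ℝ) =
      ((n' + 2 * r) ^ 3 * P.motif.card : ℕ) -
        ((Finset.univ.filter fun a : BlockIdx P (n' + 2 * r) => IsInterior r (n' + 2 * r) a.1).card : ℕ) := by
    rw [← h1]; push_cast; ring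
  rw [h4]
  push_cast
  have : ((n' : ℝ)) ^ 3 * P.motif.card ≤
      ((Finset.univ.filter fun a : BlockIdx P (n' + 2 * r) => IsInterior r (n' + 2 * r) a.1).card : ℝ) := by
    exact_mod_cast h2
  linarith

/-- **Energy of the block**: `2·E ≤ n³·2m·e(P) + (1/6)(N·tailB(R) + #non-interior · fullB)`. -/
theorem sum_sum_blockPt_le' (R : ℝ) (n' : ℕ) :
    ∑ a : BlockIdx P (n' + 2 * margin P R), ∑ b : BlockIdx P (n' + 2 * margin P R),
        lennardJones (dist (blockPt P _ a) (blockPt P _ b)) ≤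
      ((n' + 2 * margin P R : ℕ) : ℝ) ^ 3 * (2 * (P.motif.card : ℝ) * P.energyPerParticle lennardJones)
        + (1 / 6) * (((n' + 2 * margin P R : ℕ) : ℝ) ^ 3 * P.motif.card * tailB P R
          + (((n' + 2 * margin P R : ℕ) : ℝ) ^ 3 * P.motif.card - (n' : ℝ) ^ 3 * P.motif.card)
            * fullB P) := by
  set n := n' + 2 * margin P R with hn
  refine (sum_sum_blockPt_le n).trans ?_
  rw [Finset.sum_add_distrib, sum_siteSum_blockPt, ← Finset.mul_sum]
  have hout : ∑ a : BlockIdx P n, outsideSum n a ≤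
      ∑ a : BlockIdx P n, (tailB P R + (if IsInterior (margin P R) n a.1 then 0 else fullB P)) :=
    Finset.sum_le_sum fun a _ => outsideSum_le_ite R n a
  rw [Finset.sum_add_distrib, Finset.sum_const, Finset.card_univ, nsmul_eq_mul,
    Finset.sum_ite, Finset.sum_const_zero, zero_add, Finset.sum_const, nsmul_eq_mul] at hout
  have hcard : (Fintype.card (BlockIdx P n) : ℝ) = (n : ℝ) ^ 3 * P.motif.card := by
    rw [Fintype.card_prod, card_cells, Fintype.card_coe]; push_cast; ring
  rw [hcard] at hout
  have hnon := card_not_interior_le (P := P) (margin P R) n'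
  rw [← hn] at hnon
  have hfB := fullB_nonneg P
  have : ((Finset.univ.filter fun a : BlockIdx P n => ¬ IsInterior (margin P R) n a.1).card : ℝ)
      * fullB P ≤ ((n : ℝ) ^ 3 * P.motif.card - (n' : ℝ) ^ 3 * P.motif.card) * fullB P :=
    mul_le_mul_of_nonneg_right hnon hfB
  nlinarith [hout, this]

/-! ### Shells of interior block points are the shells of the motif -/

theorem shellOn_blockPt {R : ℝ} (hR : 6 / 5 ≤ R) {n : ℕ} {a : BlockIdx P n}
    (ha : IsInterior (margin P R) n a.1) (c : ℝ) :
    shellOn (blockPt P n) a c =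
      ((P.finite_inter_points (K := Metric.closedBall (a.2 : E3) (6 / 5) \ {(a.2 : E3)})
        (Metric.isBounded_closedBall.subset Set.sdiff_subset)).toFinset.image
          fun y => c⁻¹ • (y - (a.2 : E3))) := by
  ext v
  simp only [shellOn, Finset.mem_image, Finset.mem_filter, Finset.mem_univ, true_and,
    Set.Finite.mem_toFinset, Set.mem_inter_iff, Set.mem_sdiff, Metric.mem_closedBall,
    Set.mem_singleton_iff]
  constructor
  · rintro ⟨b, ⟨hba, hd⟩, rfl⟩
    have hsub : blockPt P n b - cellVec P a.1 - a.2 = blockPt P n b - blockPt P n a := by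
      simp only [blockPt]; abel
    refine ⟨blockPt P n b - cellVec P a.1, ⟨⟨?_, ?_⟩, ?_⟩, by rw [hsub]⟩
    · have : dist (blockPt P n b - cellVec P a.1) a.2 = dist (blockPt P n a) (blockPt P n b) := by
        rw [dist_eq_norm, dist_eq_norm, hsub, norm_sub_rev]
      rw [this]; exact hd
    · intro h
      apply hba
      apply blockPt_injective P n
      have : blockPt P n b - blockPt P n a = 0 := by rw [← hsub, h, sub_self]
      exact (sub_eq_zero.1 this)
    · have := P.add_mem_points (blockPt_mem_points P b) (P.lattice.neg_mem (cellVec_mem P a.1))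
      simpa [sub_eq_add_neg] using this
  · rintro ⟨y, ⟨⟨hyd, hyz⟩, hyP⟩, rfl⟩
    have huP : y + cellVec P a.1 ∈ P.points := P.add_mem_points hyP (cellVec_mem P a.1)
    have hdist : dist (blockPt P n a) (y + cellVec P a.1) = dist y a.2 := by
      simp only [blockPt, dist_comm y]
      rw [dist_eq_norm, dist_eq_norm]
      congr 1; abel
    obtain ⟨b, hb⟩ := exists_blockIdx_of_dist_le P ha huP (by rw [hdist]; exact hyd.trans hR)
    refine ⟨b, ⟨?_, ?_⟩, ?_⟩
    · intro h
      apply hyz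
      rw [h] at hb
      have : y = blockPt P n a - cellVec P a.1 := eq_sub_of_add_eq hb.symm
      rw [this, blockPt_sub_cellVec]
    · rw [hb, hdist]; exact hyd
    · rw [hb]
      congr 1
      simp only [blockPt]; abel

/-- Hence an interior block point is defective in the block iff its motif point is defective in
`P` (the predicate of item 13602). -/
theorem isDefectiveOn_blockPt_iff {R : ℝ} (hR : 6 / 5 ≤ R) {n : ℕ} {a : BlockIdx P n}
    (ha : IsInterior (margin P R) n a.1) :
    IsDefectiveOn (blockPt P n) a ↔ MotifDefective P a.2 := by
  simp only [IsDefectiveOn, MotifDefective, shellOn_blockPt hR ha]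

/-- **Defect undercount**: the block of side `n' + 2r` has at least `n'³ · motifDefects P`
defective sites. -/
theorem le_defectsOn_blockPt {R : ℝ} (hR : 6 / 5 ≤ R) (n' : ℕ) :
    n' ^ 3 * motifDefects P ≤ defectsOn (blockPt P (n' + 2 * margin P R)) := by
  set r := margin P R with hr
  let f : (Fin 3 → Fin n') × {z : {z : E3 // z ∈ P.motif} // MotifDefective P z} →
      {a : BlockIdx P (n' + 2 * r) // IsDefectiveOn (blockPt P (n' + 2 * r)) a} :=
    fun p => ⟨(shiftIdx r n' p.1, p.2.1),
      (isDefectiveOn_blockPt_iff hR (isInterior_shiftIdx r n' p.1)).2 p.2.2⟩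
  have hf : Function.Injective f := by
    rintro ⟨j, z⟩ ⟨j', z'⟩ h
    simp only [f, Subtype.mk.injEq, Prod.mk.injEq] at h
    exact Prod.ext (shiftIdx_injective r n' h.1) (Subtype.ext h.2)
  have h1 := Fintype.card_le_of_injective f hf
  unfold defectsOn
  rw [Nat.card_eq_fintype_card]
  refine le_trans (le_of_eq ?_) h1
  rw [Fintype.card_prod, card_cells, motifDefects_eq_card_filter]
  congr 1
  have e : {z : {z : E3 // z ∈ P.motif} // MotifDefective P z} ≃
      ↥(P.motif.filter (MotifDefective P)) :=
    (Equiv.subtypeSubtypeEquivSubtypeInter (fun z : E3 => z ∈ P.motif) (MotifDefective P)).trans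
      (Equiv.subtypeEquivRight fun z => Finset.mem_filter.symm)
  rw [Fintype.card_congr e, Fintype.card_coe]


/-! ### Assembly: `StarCoercivityWith g 0 → PeriodicStarCoercivityWith g` -/

theorem cube_sub_cube_le (x y : ℝ) (hx : 0 ≤ x) (hxy : x ≤ y) : y ^ 3 - x ^ 3 ≤ 3 * y ^ 2 * (y - x) := by
  nlinarith [mul_nonneg hx hx, mul_nonneg hx (sub_nonneg.2 hxy), sq_nonneg (y - x)]

/-- **Blocks of a periodic competitor are finite near-competitors**: the `C = 0` form of the
crux with constant `g` implies item 13602 with the same constant (granted the genuine infimum,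
which either side yields when `g > 0`). -/
theorem periodicStarCoercivityWith_of_starCoercivityWith
    (hB : BddBelow (Set.range fun Q : PeriodicConfiguration 3 => Q.energyPerParticle lennardJones))
    {g : ℝ} (h : StarCoercivityWith g 0) : PeriodicStarCoercivityWith g := by
  intro P
  have hm : (0 : ℝ) < P.motif.card := by exact_mod_cast Finset.card_pos.2 P.motif_nonempty
  have heP : ePer ≤ P.energyPerParticle lennardJones := ciInf_le hB P
  have hmD : (0 : ℝ) ≤ (motifDefects P : ℝ) := Nat.cast_nonneg _
  rcases lt_or_ge g 0 with hg | hg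
  · have h1 : g * (motifDefects P : ℝ) ≤ 0 := mul_nonpos_of_nonpos_of_nonneg hg.le hmD
    have : g * (motifDefects P : ℝ) / P.motif.card ≤ 0 := by
      rw [div_le_iff₀ hm]; simpa using h1
    linarith
  by_contra hlt
  push Not at hlt
  -- the deficit `ε > 0`
  obtain ⟨ε, hε_def⟩ : ∃ ε : ℝ, ε = ePer + g * (motifDefects P : ℝ) / P.motif.card -
      P.energyPerParticle lennardJones := ⟨_, rfl⟩
  have hε : 0 < ε := by rw [hε_def]; linarith
  have he : (P.motif.card : ℝ) * P.energyPerParticle lennardJones =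
      P.motif.card * ePer + g * (motifDefects P : ℝ) - P.motif.card * ε := by
    rw [hε_def]; field_simp; ring
  -- radius with small tails; interior margin; block side
  obtain ⟨R, hR2, htail⟩ := exists_tailB_lt P hε
  have hR : 6 / 5 ≤ R := by linarith
  obtain ⟨r, hr_def⟩ : ∃ r : ℕ, r = margin P R := ⟨_, rfl⟩
  have hr1 : (1 : ℝ) ≤ r := by
    rw [hr_def]; unfold margin; push_cast
    linarith [(Nat.cast_nonneg _ : (0 : ℝ) ≤ ⌈coordC P * (R + motifDiam P)⌉₊)]
  have hfB := fullB_nonneg P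
  have htB := tailB_nonneg P R
  obtain ⟨K, hK_def⟩ : ∃ K : ℝ, K = g * (motifDefects P : ℝ) / P.motif.card + fullB P / 12 + 1 :=
    ⟨_, rfl⟩
  have hK : 0 < K := by rw [hK_def]; positivity
  obtain ⟨n', hn'⟩ := exists_nat_gt (12 * r * K / ε)
  have hn'pos : (0 : ℝ) < n' := lt_of_le_of_lt (by positivity) hn'
  obtain ⟨n, hn_def⟩ : ∃ n : ℕ, n = n' + 2 * r := ⟨_, rfl⟩
  have hnn : (n : ℝ) = n' + 2 * r := by rw [hn_def]; push_cast; ring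
  have hnpos : (0 : ℝ) < n := by linarith
  -- the crux applied to the block, re-indexed by `Fin N`
  have hx : Function.Injective (blockPt P n ∘ (Fintype.equivFin (BlockIdx P n)).symm) :=
    (blockPt_injective P n).comp (Equiv.injective _)
  have hcard : (Fintype.card (BlockIdx P n) : ℝ) = (n : ℝ) ^ 3 * P.motif.card := by
    rw [Fintype.card_prod, card_cells, Fintype.card_coe]; push_cast; ring
  have key := h _ _ hx
  simp only [zero_mul, sub_zero] at key
  rw [hcard, defects_comp_equiv] at key
  -- defects undercount and energy of the block
  have hD : (n' : ℝ) ^ 3 * (motifDefects P : ℝ) ≤ (defectsOn (blockPt P n) : ℝ) := by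
    have := le_defectsOn_blockPt (P := P) hR n'
    rw [← hr_def, ← hn_def] at this
    exact_mod_cast this
  have hgD : g * ((n' : ℝ) ^ 3 * (motifDefects P : ℝ)) ≤ g * (defectsOn (blockPt P n) : ℝ) :=
    mul_le_mul_of_nonneg_left hD hg
  have hE := sum_sum_blockPt_le' (P := P) R n'
  rw [← hr_def, ← hn_def,
    ← two_mul_interactionEnergy_comp_equiv (Fintype.equivFin (BlockIdx P n)).symm (blockPt P n)]
    at hE
  -- (I) the deficit inequality for the block
  have he3 : (n : ℝ) ^ 3 * ((P.motif.card : ℝ) * P.energyPerParticle lennardJones) =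
      (n : ℝ) ^ 3 * (P.motif.card * ePer + g * (motifDefects P : ℝ) - P.motif.card * ε) := by
    rw [he]
  have hI : (n : ℝ) ^ 3 * P.motif.card * ε ≤
      g * (motifDefects P : ℝ) * ((n : ℝ) ^ 3 - (n' : ℝ) ^ 3) +
        (1 / 12) * ((n : ℝ) ^ 3 * P.motif.card * tailB P R) +
        (1 / 12) * (((n : ℝ) ^ 3 - (n' : ℝ) ^ 3) * P.motif.card * fullB P) := by
    linarith only [key, hE, hgD, he3]
  -- (II) tails `< ε`, boundary layer `≤ 6 r n²` cells thick
  have hcube : (n : ℝ) ^ 3 - (n' : ℝ) ^ 3 ≤ 6 * r * (n : ℝ) ^ 2 := by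
    have := cube_sub_cube_le (n' : ℝ) (n : ℝ) hn'pos.le (by linarith)
    calc (n : ℝ) ^ 3 - (n' : ℝ) ^ 3 ≤ 3 * (n : ℝ) ^ 2 * (n - n') := this
      _ = 6 * r * (n : ℝ) ^ 2 := by rw [hnn]; ring
  have hc : 0 ≤ g * (motifDefects P : ℝ) + P.motif.card * fullB P / 12 := by positivity
  have hc2 := mul_le_mul_of_nonneg_right hcube hc
  have hN0 : 0 ≤ (n : ℝ) ^ 3 * P.motif.card := by positivity
  have ht2 := mul_le_mul_of_nonneg_left htail.le hN0
  have hII : (11 / 12) * ((n : ℝ) ^ 3 * P.motif.card * ε) ≤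
      6 * r * (n : ℝ) ^ 2 * (g * (motifDefects P : ℝ) + P.motif.card * fullB P / 12) := by
    linarith only [hI, hc2, ht2]
  -- (III) divide by `n²`
  have hn2 : (0 : ℝ) < (n : ℝ) ^ 2 := by positivity
  have hIII : (11 / 12) * ((n : ℝ) * P.motif.card * ε) ≤
      6 * r * (g * (motifDefects P : ℝ) + P.motif.card * fullB P / 12) := by
    refine le_of_mul_le_mul_right ?_ hn2
    linarith only [hII]
  -- (IV) but `n ≥ n' > 12 r K / ε`
  have hnK : 12 * r * K < (n : ℝ) * ε := by
    have h5 : 12 * r * K < (n' : ℝ) * ε := by rwa [div_lt_iff₀ hε] at hn'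
    have h6 : (n' : ℝ) * ε ≤ (n : ℝ) * ε := mul_le_mul_of_nonneg_right (by linarith) hε.le
    linarith
  have h12 : 12 * r * (g * (motifDefects P : ℝ) + P.motif.card * fullB P / 12 + P.motif.card) <
      (n : ℝ) * P.motif.card * ε := by
    have h' := mul_lt_mul_of_pos_right hnK hm
    have hKm : 12 * (r : ℝ) * K * P.motif.card =
        12 * r * (g * (motifDefects P : ℝ) + P.motif.card * fullB P / 12 + P.motif.card) := by
      rw [hK_def]; field_simp
    linarith
  have hr0 : (0 : ℝ) ≤ r := by linarith
  have hrm : (P.motif.card : ℝ) ≤ r * P.motif.card := le_mul_of_one_le_left hm.le hr1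
  have hrc := mul_nonneg hr0 hc
  linarith only [hIII, h12, hrm, hrc, hm]


/-- **Trial blocks** (the finite-volume half of item 11865/0629, along `N = n³·#motif`): for every
periodic `P`, every `ε > 0` and every `n₀`, some block of `P` with `N ≥ n₀` points is an
injective configuration with `E_LJ ≤ N·(e(P) + ε)`.  (General `N`: pad the largest block below
`N` with far-away particles, whose cross terms are `≤ 0`; left to the prover of 11865.) -/
theorem exists_block_energy_le (P : PeriodicConfiguration 3) {ε : ℝ} (hε : 0 < ε) (n₀ : ℕ) :
    ∃ (N : ℕ) (x : Fin N → E3), n₀ ≤ N ∧ Function.Injective x ∧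
      interactionEnergy lennardJones x ≤ (N : ℝ) * (P.energyPerParticle lennardJones + ε) := by
  have hm : (0 : ℝ) < P.motif.card := by exact_mod_cast Finset.card_pos.2 P.motif_nonempty
  have hm1 : (1 : ℝ) ≤ P.motif.card := by exact_mod_cast Finset.card_pos.2 P.motif_nonempty
  obtain ⟨R, hR2, htail⟩ := exists_tailB_lt P hε
  obtain ⟨r, hr_def⟩ : ∃ r : ℕ, r = margin P R := ⟨_, rfl⟩
  have hr0 : (0 : ℝ) ≤ r := Nat.cast_nonneg _
  have hfB := fullB_nonneg P
  obtain ⟨n', hn'⟩ := exists_nat_gt (r * fullB P / ε + n₀)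
  have hn'pos : (0 : ℝ) < n' := lt_of_le_of_lt (by positivity) hn'
  obtain ⟨n, hn_def⟩ : ∃ n : ℕ, n = n' + 2 * r := ⟨_, rfl⟩
  have hnn : (n : ℝ) = n' + 2 * r := by rw [hn_def]; push_cast; ring
  have hx : Function.Injective (blockPt P n ∘ (Fintype.equivFin (BlockIdx P n)).symm) :=
    (blockPt_injective P n).comp (Equiv.injective _)
  have hcard : (Fintype.card (BlockIdx P n) : ℝ) = (n : ℝ) ^ 3 * P.motif.card := by
    rw [Fintype.card_prod, card_cells, Fintype.card_coe]; push_cast; ring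
  refine ⟨Fintype.card (BlockIdx P n), _, ?_, hx, ?_⟩
  · -- `n₀ ≤ n' ≤ n ≤ n³·m`
    have h1 : (n₀ : ℝ) < n' := lt_of_le_of_lt (by
      have : 0 ≤ r * fullB P / ε := by positivity
      linarith) hn'
    have h2 : (n' : ℝ) ≤ Fintype.card (BlockIdx P n) := by
      rw [hcard]
      have hn1 : (1 : ℝ) ≤ n := by
        have : (1 : ℝ) ≤ n' := by exact_mod_cast Nat.one_le_iff_ne_zero.2 (by rintro rfl; simp at hn'pos)
        linarith
      calc (n' : ℝ) ≤ n := by linarith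
        _ = n * 1 * 1 := by ring
        _ ≤ n * n ^ 2 * P.motif.card := by gcongr; nlinarith
        _ = (n : ℝ) ^ 3 * P.motif.card := by ring
    exact_mod_cast (h1.le.trans h2)
  · have hE := sum_sum_blockPt_le' (P := P) R n'
    rw [← hr_def, ← hn_def,
      ← two_mul_interactionEnergy_comp_equiv (Fintype.equivFin (BlockIdx P n)).symm (blockPt P n)]
      at hE
    rw [hcard]
    have hcube : (n : ℝ) ^ 3 - (n' : ℝ) ^ 3 ≤ 6 * r * (n : ℝ) ^ 2 := by
      have := cube_sub_cube_le (n' : ℝ) (n : ℝ) hn'pos.le (by linarith)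
      calc (n : ℝ) ^ 3 - (n' : ℝ) ^ 3 ≤ 3 * (n : ℝ) ^ 2 * (n - n') := this
        _ = 6 * r * (n : ℝ) ^ 2 := by rw [hnn]; ring
    have hc : 0 ≤ (P.motif.card : ℝ) * fullB P := by positivity
    have hc2 := mul_le_mul_of_nonneg_right hcube hc
    have hN0 : 0 ≤ (n : ℝ) ^ 3 * P.motif.card := by positivity
    have ht2 := mul_le_mul_of_nonneg_left htail.le hN0
    -- `r·fullB ≤ n·ε`
    have hrn : r * fullB P ≤ (n : ℝ) * ε := by
      have h1 : r * fullB P / ε < n' := lt_of_le_of_lt (by linarith [(Nat.cast_nonneg n₀ : (0:ℝ) ≤ n₀)]) hn'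
      rw [div_lt_iff₀ hε] at h1
      have : (n' : ℝ) * ε ≤ n * ε := mul_le_mul_of_nonneg_right (by linarith) hε.le
      linarith
    have hn2 : 0 ≤ (n : ℝ) ^ 2 * P.motif.card := by positivity
    have hrn2 := mul_le_mul_of_nonneg_right hrn hn2
    have hpos : 0 ≤ (n : ℝ) ^ 3 * P.motif.card * ε := by positivity
    linarith only [hE, hc2, ht2, hrn2, hpos]

/-! ### Consequences: `g⋆ = g⋆_per` and `13600 ⇔ 13602` -/

/-- **`g⋆ ≤ g⋆_per`** (granted the genuine infimum) … -/
theorem gStar_le_gPer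
    (hB : BddBelow (Set.range fun Q : PeriodicConfiguration 3 => Q.energyPerParticle lennardJones)) :
    gStar ≤ gPer :=
  le_gPer_of_periodicStarCoercivityWith
    (periodicStarCoercivityWith_of_starCoercivityWith hB (starCoercivityWith_gStar hB))

/-- … so **the finite and the periodic extremal constants coincide**. -/
theorem gStar_eq_gPer
    (hB : BddBelow (Set.range fun Q : PeriodicConfiguration 3 => Q.energyPerParticle lennardJones)) :
    gStar = gPer :=
  le_antisymm (gStar_le_gPer hB) (gPer_le_gStar hB)

/-- The admissible constants agree: `StarCoercivityWith g 0 ↔ PeriodicStarCoercivityWith g`. -/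
theorem starCoercivityWith_iff_periodicStarCoercivityWith
    (hB : BddBelow (Set.range fun Q : PeriodicConfiguration 3 => Q.energyPerParticle lennardJones))
    (g : ℝ) : StarCoercivityWith g 0 ↔ PeriodicStarCoercivityWith g :=
  ⟨periodicStarCoercivityWith_of_starCoercivityWith hB,
    starCoercivityWith_of_periodicStarCoercivityWith hB⟩

open Summit.AtomisticToContinuum.Crystallization.Theses.ReggeStarCoercivity (PeriodicStarCoercivity) in
/-- **Items 13600 and 13602 are equivalent** (no hypothesis: either side yields the genuine
infimum), with the SAME constant `g`.  For the adversary: every periodic competitor `P` with a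
defective motif point certifies `g ≤ (e(P) − e_per)·#motif/motifDefects P` for every admissible
`g` of the crux — the physics ledger's caps are now caps on `g⋆` itself (modulo `e_per`). -/
theorem starCoercivity_iff_periodicStarCoercivity : StarCoercivity ↔ PeriodicStarCoercivity := by
  constructor
  · intro h
    have hB := bddBelow_of_starCoercivity h
    obtain ⟨g, hg, C, hgC⟩ := starCoercivity_iff.1 h
    exact periodicStarCoercivity_iff.2
      ⟨g, hg, periodicStarCoercivityWith_of_starCoercivityWith hB hgC.zero_slack⟩
  · exact starCoercivity_of_periodicStarCoercivity

/-- **A periodic competitor caps every admissible `g`** (the adversary's tool, now certified):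
if `StarCoercivityWith g C` with `g > 0` and `P` has a defective motif point, then
`g ≤ (e(P) − e_per)·#motif / motifDefects P`. -/
theorem g_le_periodicQuotient {g C : ℝ} (hg : 0 < g) (h : StarCoercivityWith g C)
    (P : PeriodicConfiguration 3) (hP : 0 < motifDefects P) : g ≤ periodicQuotient P := by
  have hB := bddBelow_of_starCoercivity (starCoercivity_iff.2 ⟨g, hg, C, h⟩)
  have hP' := periodicStarCoercivityWith_of_starCoercivityWith hB h.zero_slack
  exact (le_gPer_of_periodicStarCoercivityWith hP').trans
    (csInf_le (periodicQuotientSet_bddBelow hB) ⟨P, hP, rfl⟩)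


/-- **Item 0714 (`CrysPeriodicBddBelow`) from trial blocks**: periodic Lennard-Jones energies
per particle are bounded below (by the finite stability constant `+1`): `−C·N ≤ E(block) ≤
N·(e(P) + 1)`.  Hence every `BddBelow` hypothesis in this file is DISCHARGED (primed versions
below).  (A sibling seat attached independent candidate proofs of 0714; this one is 10 lines on
top of §12.) -/
theorem bddBelow_range_energyPerParticle :
    BddBelow (Set.range fun Q : PeriodicConfiguration 3 => Q.energyPerParticle lennardJones) := by
  obtain ⟨C, hC⟩ := lennardJones_stable_holds 3 (by norm_num)
  refine ⟨-(C + 1), ?_⟩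
  rintro _ ⟨P, rfl⟩
  obtain ⟨N, x, hN, hx, hE⟩ := exists_block_energy_le P one_pos 1
  have h1 := hC N x hx
  have hNr : (1 : ℝ) ≤ N := by exact_mod_cast hN
  have h2 : -(C * (N : ℝ)) ≤ (N : ℝ) * (P.energyPerParticle lennardJones + 1) := h1.trans hE
  by_contra hlt
  push Not at hlt
  nlinarith

/-! ### Everything unconditional -/

theorem starCoercivity_iff_gStar_pos' : StarCoercivity ↔ 0 < gStar := by
  rw [starCoercivity_iff_gStar_pos]
  exact ⟨fun h => h.2, fun h => ⟨bddBelow_range_energyPerParticle, h⟩⟩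

open Summit.AtomisticToContinuum.Crystallization.Theses.ReggeStarCoercivity (PeriodicStarCoercivity) in
theorem periodicStarCoercivity_iff_gPer_pos' : PeriodicStarCoercivity ↔ 0 < gPer := by
  rw [periodicStarCoercivity_iff_gPer_pos]
  exact ⟨fun h => h.2, fun h => ⟨bddBelow_range_energyPerParticle, h⟩⟩

theorem gStar_eq_gPer' : gStar = gPer := gStar_eq_gPer bddBelow_range_energyPerParticle

theorem starCoercivityWith_gStar' : StarCoercivityWith gStar 0 :=
  starCoercivityWith_gStar bddBelow_range_energyPerParticle

theorem starCoercivityWith_iff_le_gStar' (g C : ℝ) (hC : 0 ≤ C) : StarCoercivityWith g C ↔ g ≤ gStar :=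
  starCoercivityWith_iff_le_gStar bddBelow_range_energyPerParticle g C hC

/-- `N·e_per ≤ E_LJ(x)` for every injective `x`, unconditionally (§5 discharged). -/
theorem card_mul_ePer_le_interactionEnergy' {N : ℕ} {x : Fin N → E3} (hx : Function.Injective x) :
    (N : ℝ) * ePer ≤ interactionEnergy lennardJones x :=
  card_mul_ePer_le_interactionEnergy bddBelow_range_energyPerParticle hx

theorem gStar_nonneg' : 0 ≤ gStar := gStar_nonneg bddBelow_range_energyPerParticle

/-- **The kill criterion, final form.** `¬ StarCoercivity ↔ g⋆ ≤ 0 ↔` for every `ε > 0` some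
injective configuration with a defective site has excess `E_LJ(x) − N·e_per < ε·#Def(x)`;
equivalently (§12) some periodic `P` with a defective motif point has
`e(P) − e_per < ε·motifDefects P/#motif`. -/
theorem not_starCoercivity_iff' :
    ¬ StarCoercivity ↔ ∀ ε : ℝ, 0 < ε → ∃ (N : ℕ) (x : Fin N → E3), Function.Injective x ∧
      0 < defects x ∧ interactionEnergy lennardJones x - (N : ℝ) * ePer < ε * (defects x : ℝ) := by
  rw [starCoercivity_iff_gStar_pos', not_lt]
  exact gStar_nonpos_iff bddBelow_range_energyPerParticle

end Blocks

end Summit.AtomisticToContinuum.Crystallization.Cruxes.StarCoercivity.Disproof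

end
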